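import Literature.Computability.Complexity.StackZnVectors
import HarnessLib

/-!
# Numeric register programs: a register-transfer language over numerals and queues of numerals

Literature / complexity toolkit, continuing `StackNumeric.lean` (numeric procedures `nAdd`,
`nSub`, `nCmp`, `nMul`, `nDivMod`, `nToUnary` on the layer `EReg ⊕ β`, states `base T`),
`StackStreams.lean` (`readItem`, `ifNonempty`, `countLoop`), `StackLists.lean` (`emit`,
`outRev`) and `StackZnVectors.lean` (the vector coding `encVec`).  The machines of
number-theoretic algorithms with many nested loops over lists of residues (the target being
the deterministic factoring machine of Harvey 2021, fact
`Literature.Computability.Cryptography.harvey_factoring_one_fifth`) are not written register by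
register: this file provides a small imperative language whose programs denote *total functions
on an abstract state* and compile to stack programs with a proved step bound, so that an
algorithm is verified over `ℕ` and `List ℕ` only.

* `NState S V O` — abstract states: scalar registers `S → ℕ`, *queues* `V → List ℕ` (read at
  the front), *accumulators* `O → List ℕ` (written at the back), and two instruments: `peak`
  (a bound on every number ever held) and `steps` (abstract work done so far);
* `NCom S V O E` — programs: constants, moves, `+`, `∸`, `*`, `/%`, bit size on scalars; `pop`
  (front of a queue into a scalar, `0` if empty), `push` (scalar onto the front of a queue),
  `emit` (scalar to the back of an accumulator), `pour` (an accumulator becomes the front of a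
  queue), `clearV`/`clearO`; sequencing, `ifPos`,
  `ifLt`, `ifEmpty`, the counted loop `times x c` (run `c` exactly `x` times), and extension
  opcodes `ext e` (`e : E`) whose meaning and code are supplied by an `NExt` structure (the slot
  for separately verified bricks such as a fast polynomial multiplier);
* `NCom.eval` — the semantics, a total function `NState → NState` (loops are counted, so
  every program terminates), instrumented: `peak := max peak (new value)`, `steps += 1` per
  instruction, `+ (|list| + 1)` for whole-register operations, `+ (x + 1)` for entering a loop
  of `x` rounds;
* `NCom.compile d c : Com (EReg ⊕ NBank S V O X)` — the stack program (outer bank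
  `NBank S V O X = ((S ⊕ V) ⊕ O) ⊕ (NWork ⊕ X)`: the named registers, the work registers
  `NWork` — token, scratch, flag, eight unary loop counters, one per nesting depth `d` — and an
  extension bank `X` for the bricks), and the register coding `NState.enc κ σ` (scalars as
  numerals `encodeNat`, queues as `encVec`, accumulators as `outRev`, counters `κ`);
* **`NCom.runs`** — *the simulation theorem*: for a well-formed program (`NCom.wf`: loop
  nesting within the eight counters, distinct operands of `/%`), a well-formed state
  (`NState.WF`: every number at most `peak`) and an execution meeting the preconditions of
  the extension opcodes it calls (`NCom.extOK`),
  `Runs (compile d c) (enc κ σ) (enc κ (eval c σ)) (K · (steps' - steps) · (size peak' + 2)³)`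
  with an absolute constant `K` (`NCom.K0 = 512`, or the brick's constant if larger): the
  machine cost is the abstract work times a fixed polynomial of the bit size of the largest
  number.  Consequently an algorithm written in `NCom` is verified by reasoning about `eval`
  alone (functional correctness, a bound on `steps`, a bound on `peak`).

Design notes.  Queues and accumulators are the honest stack discipline (a stack register is
read at its top and an output list is cheapest built reversed; `pour` is the reversal that
turns one into the other), so no amortisation argument is hidden in the theorem.  Truncated
subtraction and division by zero follow `ℕ` (`nSub`'s no-borrow precondition and `nDivMod`'s
nonzero divisor are established by compiled tests).  The loop counter of `times` is converted
to unary once (`nToUnary`, linear in the count), which the abstract cost `x + 1` pays for.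

## References

* T. Nipkow, G. Klein, *Concrete Semantics with Isabelle/HOL*, Springer 2014, §7.2 (big-step
  semantics as the specification of a compiler), Ch. 8 (compiler correctness by induction on
  the source program) — the method, here with step counting. (Folklore material, fully proved
  here.)
* D. Harvey, *An exponent one-fifth algorithm for deterministic integer factorisation*, Math.
  Comp. 90 (2021), §2.1 (the cost model: integer operations on a multitape machine, every
  scalar operation polynomial in `lg N`) [Harvey2021].
-/

namespace Literature.Computability.Complexity

open _root_.Computability SProg

/-! ### Register banks and abstract states -/

/-- The work registers of compiled numeric programs: the token register of the item reader,
a scratch register (emitted scalars, the reader's reversal buffer), the comparison flag, and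
eight unary loop counters (one per nesting depth of `times`). [folklore] -/
inductive NWork where
  | tok | scr | flg | c0 | c1 | c2 | c3 | c4 | c5 | c6 | c7
  deriving DecidableEq, Fintype, Repr

namespace NWork

/-- The loop counter of nesting depth `d` (depths `≥ 8` are not compiled; see `NCom.wf`).
[folklore] -/
def ctr : ℕ → NWork
  | 0 => c0 | 1 => c1 | 2 => c2 | 3 => c3 | 4 => c4 | 5 => c5 | 6 => c6 | _ => c7

/-- The depth of a work register as a counter (`8` for the non-counters). [folklore] -/
def depth : NWork → ℕ
  | c0 => 0 | c1 => 1 | c2 => 2 | c3 => 3 | c4 => 4 | c5 => 5 | c6 => 6 | c7 => 7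
  | tok => 8 | scr => 8 | flg => 8

/-- The counter of depth `d < 8` has depth `d`. [folklore] -/
theorem depth_ctr {d : ℕ} (hd : d < 8) : (ctr d).depth = d := by
  match d, hd with
  | 0, _ => rfl | 1, _ => rfl | 2, _ => rfl | 3, _ => rfl
  | 4, _ => rfl | 5, _ => rfl | 6, _ => rfl | 7, _ => rfl
  | n + 8, h => omega

/-- A counter is not the token register. [folklore] -/
theorem ctr_ne_tok (d : ℕ) : ctr d ≠ tok := by
  unfold ctr; split <;> simp
/-- A counter is not the scratch register. [folklore] -/
theorem ctr_ne_scr (d : ℕ) : ctr d ≠ scr := by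
  unfold ctr; split <;> simp
/-- A counter is not the flag register. [folklore] -/
theorem ctr_ne_flg (d : ℕ) : ctr d ≠ flg := by
  unfold ctr; split <;> simp

end NWork

/-- The outer register bank of compiled numeric programs: scalar names `S`, queue names `V`,
accumulator names `O`, the work registers, and an extension bank `X` (scratch of external
bricks). [folklore] -/
abbrev NBank (S V O X : Type) : Type := ((S ⊕ V) ⊕ O) ⊕ (NWork ⊕ X)

namespace NBank

variable {S V O X : Type}

/-- A scalar register. [folklore] -/
@[match_pattern, reducible] def rS (s : S) : NBank S V O X := Sum.inl (Sum.inl (Sum.inl s))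
/-- A queue register. [folklore] -/
@[match_pattern, reducible] def rV (v : V) : NBank S V O X := Sum.inl (Sum.inl (Sum.inr v))
/-- An accumulator register. [folklore] -/
@[match_pattern, reducible] def rO (o : O) : NBank S V O X := Sum.inl (Sum.inr o)
/-- A work register. [folklore] -/
@[match_pattern, reducible] def rW (w : NWork) : NBank S V O X := Sum.inr (Sum.inl w)
/-- An extension register. [folklore] -/
@[match_pattern, reducible] def rX (x : X) : NBank S V O X := Sum.inr (Sum.inr x)

end NBank

open NBank

/-- Abstract states of numeric programs: scalars, queues (front = head), accumulators (in
emission order), the bound `peak` on every number held so far and the abstract work `steps`.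
[folklore] -/
structure NState (S V O : Type) where
  /-- scalar registers -/ sc : S → ℕ
  /-- queues, read at the head -/ vi : V → List ℕ
  /-- accumulators, written at the end -/ vo : O → List ℕ
  /-- a bound on every number held so far -/ peak : ℕ
  /-- abstract work so far -/ steps : ℕ

namespace NState

variable {S V O : Type}

/-- Write a scalar. [folklore] -/
def setSc [DecidableEq S] (σ : NState S V O) (x : S) (a : ℕ) : NState S V O :=
  { σ with sc := Function.update σ.sc x a }
/-- Write a queue. [folklore] -/
def setVi [DecidableEq V] (σ : NState S V O) (v : V) (l : List ℕ) : NState S V O :=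
  { σ with vi := Function.update σ.vi v l }
/-- Write an accumulator. [folklore] -/
def setVo [DecidableEq O] (σ : NState S V O) (o : O) (l : List ℕ) : NState S V O :=
  { σ with vo := Function.update σ.vo o l }

/-- Record a new number `a` and `k` units of work. [folklore] -/
def bump (σ : NState S V O) (a k : ℕ) : NState S V O :=
  { σ with peak := max σ.peak a, steps := σ.steps + k }

section SetterLemmas

/-- Projection `sc` after `setSc`. [folklore] -/
@[simp] theorem sc_setSc [DecidableEq S] (σ : NState S V O) (x : S) (a : ℕ) :
    (σ.setSc x a).sc = Function.update σ.sc x a := rfl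
/-- Projection `vi` after `setSc`. [folklore] -/
@[simp] theorem vi_setSc [DecidableEq S] (σ : NState S V O) (x : S) (a : ℕ) : (σ.setSc x a).vi = σ.vi := rfl
/-- Projection `vo` after `setSc`. [folklore] -/
@[simp] theorem vo_setSc [DecidableEq S] (σ : NState S V O) (x : S) (a : ℕ) : (σ.setSc x a).vo = σ.vo := rfl
/-- Projection `peak` after `setSc`. [folklore] -/
@[simp] theorem peak_setSc [DecidableEq S] (σ : NState S V O) (x : S) (a : ℕ) : (σ.setSc x a).peak = σ.peak := rfl
/-- Projection `steps` after `setSc`. [folklore] -/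
@[simp] theorem steps_setSc [DecidableEq S] (σ : NState S V O) (x : S) (a : ℕ) : (σ.setSc x a).steps = σ.steps := rfl
/-- Projection `sc` after `setVi`. [folklore] -/
@[simp] theorem sc_setVi [DecidableEq V] (σ : NState S V O) (v : V) (l : List ℕ) : (σ.setVi v l).sc = σ.sc := rfl
/-- Projection `vi` after `setVi`. [folklore] -/
@[simp] theorem vi_setVi [DecidableEq V] (σ : NState S V O) (v : V) (l : List ℕ) :
    (σ.setVi v l).vi = Function.update σ.vi v l := rfl
/-- Projection `vo` after `setVi`. [folklore] -/
@[simp] theorem vo_setVi [DecidableEq V] (σ : NState S V O) (v : V) (l : List ℕ) : (σ.setVi v l).vo = σ.vo := rfl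
/-- Projection `peak` after `setVi`. [folklore] -/
@[simp] theorem peak_setVi [DecidableEq V] (σ : NState S V O) (v : V) (l : List ℕ) : (σ.setVi v l).peak = σ.peak := rfl
/-- Projection `steps` after `setVi`. [folklore] -/
@[simp] theorem steps_setVi [DecidableEq V] (σ : NState S V O) (v : V) (l : List ℕ) : (σ.setVi v l).steps = σ.steps := rfl
/-- Projection `sc` after `setVo`. [folklore] -/
@[simp] theorem sc_setVo [DecidableEq O] (σ : NState S V O) (o : O) (l : List ℕ) : (σ.setVo o l).sc = σ.sc := rfl
/-- Projection `vi` after `setVo`. [folklore] -/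
@[simp] theorem vi_setVo [DecidableEq O] (σ : NState S V O) (o : O) (l : List ℕ) : (σ.setVo o l).vi = σ.vi := rfl
/-- Projection `vo` after `setVo`. [folklore] -/
@[simp] theorem vo_setVo [DecidableEq O] (σ : NState S V O) (o : O) (l : List ℕ) :
    (σ.setVo o l).vo = Function.update σ.vo o l := rfl
/-- Projection `peak` after `setVo`. [folklore] -/
@[simp] theorem peak_setVo [DecidableEq O] (σ : NState S V O) (o : O) (l : List ℕ) : (σ.setVo o l).peak = σ.peak := rfl
/-- Projection `steps` after `setVo`. [folklore] -/
@[simp] theorem steps_setVo [DecidableEq O] (σ : NState S V O) (o : O) (l : List ℕ) : (σ.setVo o l).steps = σ.steps := rfl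
/-- Projection `sc` after `bump`. [folklore] -/
@[simp] theorem sc_bump (σ : NState S V O) (a k : ℕ) : (σ.bump a k).sc = σ.sc := rfl
/-- Projection `vi` after `bump`. [folklore] -/
@[simp] theorem vi_bump (σ : NState S V O) (a k : ℕ) : (σ.bump a k).vi = σ.vi := rfl
/-- Projection `vo` after `bump`. [folklore] -/
@[simp] theorem vo_bump (σ : NState S V O) (a k : ℕ) : (σ.bump a k).vo = σ.vo := rfl
/-- Projection `peak` after `bump`. [folklore] -/
@[simp] theorem peak_bump (σ : NState S V O) (a k : ℕ) : (σ.bump a k).peak = max σ.peak a := rfl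
/-- Projection `steps` after `bump`. [folklore] -/
@[simp] theorem steps_bump (σ : NState S V O) (a k : ℕ) : (σ.bump a k).steps = σ.steps + k := rfl

end SetterLemmas

/-- Well-formed states: every number held is at most `peak`. [folklore] -/
structure WF (σ : NState S V O) : Prop where
  sc_le : ∀ x, σ.sc x ≤ σ.peak
  vi_le : ∀ v, ∀ a ∈ σ.vi v, a ≤ σ.peak
  vo_le : ∀ o, ∀ a ∈ σ.vo o, a ≤ σ.peak

/-- `σ ≼ τ`: the instruments only grow. [folklore] -/
def Mono (σ τ : NState S V O) : Prop := σ.peak ≤ τ.peak ∧ σ.steps ≤ τ.steps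

/-- `Mono.rfl`. [folklore] -/
theorem Mono.rfl {σ : NState S V O} : Mono σ σ := ⟨le_rfl, le_rfl⟩

/-- `Mono.trans`. [folklore] -/
theorem Mono.trans {σ τ υ : NState S V O} (h₁ : Mono σ τ) (h₂ : Mono τ υ) : Mono σ υ :=
  ⟨h₁.1.trans h₂.1, h₁.2.trans h₂.2⟩

/-- `mono_bump`. [folklore] -/
theorem mono_bump (σ : NState S V O) (a k : ℕ) : Mono σ (σ.bump a k) :=
  ⟨le_max_left _ _, Nat.le_add_right _ _⟩

end NState

/-! ### Syntax -/

/-- Numeric register programs (see the module docstring for the instruction set). [folklore] -/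
inductive NCom (S V O E : Type) : Type where
  | setc (x : S) (c : ℕ)
  | mov (x y : S)
  | add (x y z : S)
  | sub (x y z : S)
  | mul (x y z : S)
  | divmod (q r y z : S)
  | sizeOf (x y : S)
  | pop (v : V) (x : S)
  | push (v : V) (x : S)
  | emit (o : O) (x : S)
  | pour (o : O) (v : V)
  | clearV (v : V)
  | clearO (o : O)
  | skip
  | seq (c₁ c₂ : NCom S V O E)
  | ifPos (x : S) (c₁ c₂ : NCom S V O E)
  | ifLt (y z : S) (c₁ c₂ : NCom S V O E)
  | ifEmpty (v : V) (c₁ c₂ : NCom S V O E)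
  | times (x : S) (c : NCom S V O E)
  | ext (e : E)

/-- Sequential composition of numeric programs. [folklore] -/
infixr:30 " ;ₙ " => NCom.seq

/-- Extension opcodes: their stack code over the outer bank and their meaning on abstract
states (soundness, `NExt.Sound`, is a hypothesis of the simulation theorem). [folklore] -/
structure NExt (S V O X E : Type) where
  /-- the stack program of an opcode -/ com : E → Com (EReg ⊕ NBank S V O X)
  /-- its meaning on abstract states -/ sem : E → NState S V O → NState S V O
  /-- its precondition: the states on which the code realises the meaning (bricks are
  verified under hypotheses — lengths, reduced entries, odd modulus; `NCom.extOK` collects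
  them along an execution) -/ pre : E → NState S V O → Prop

/-- The empty extension (no opcodes). [folklore] -/
def NExt.empty (S V O X : Type) : NExt S V O X Empty where
  com := fun e => e.elim
  sem := fun e => e.elim
  pre := fun e => e.elim

namespace NCom

variable {S V O X E : Type}

/-! ### Semantics -/

section Eval

variable [DecidableEq S] [DecidableEq V] [DecidableEq O]

/-- The semantics of numeric programs: a total function on abstract states, instrumented with
`peak` and `steps` (see the module docstring). [folklore] -/
def eval (𝓔 : NExt S V O X E) : NCom S V O E → NState S V O → NState S V O
  | setc x c, σ => (σ.setSc x c).bump c 1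
  | mov x y, σ => (σ.setSc x (σ.sc y)).bump 0 1
  | add x y z, σ => (σ.setSc x (σ.sc y + σ.sc z)).bump (σ.sc y + σ.sc z) 1
  | sub x y z, σ => (σ.setSc x (σ.sc y - σ.sc z)).bump 0 1
  | mul x y z, σ => (σ.setSc x (σ.sc y * σ.sc z)).bump (σ.sc y * σ.sc z) 1
  | divmod q r y z, σ => ((σ.setSc q (σ.sc y / σ.sc z)).setSc r (σ.sc y % σ.sc z)).bump 0 1
  | sizeOf x y, σ => (σ.setSc x (σ.sc y).size).bump (σ.sc y).size 1
  | pop v x, σ => ((σ.setSc x ((σ.vi v).headD 0)).setVi v (σ.vi v).tail).bump 0 1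
  | push v x, σ => (σ.setVi v (σ.sc x :: σ.vi v)).bump 0 1
  | emit o x, σ => (σ.setVo o (σ.vo o ++ [σ.sc x])).bump 0 1
  | pour o v, σ => ((σ.setVi v (σ.vo o ++ σ.vi v)).setVo o []).bump 0 ((σ.vo o).length + 1)
  | clearV v, σ => (σ.setVi v []).bump 0 ((σ.vi v).length + 1)
  | clearO o, σ => (σ.setVo o []).bump 0 ((σ.vo o).length + 1)
  | skip, σ => σ
  | seq c₁ c₂, σ => eval 𝓔 c₂ (eval 𝓔 c₁ σ)
  | ifPos x c₁ c₂, σ => if 0 < σ.sc x then eval 𝓔 c₁ (σ.bump 0 1) else eval 𝓔 c₂ (σ.bump 0 1)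
  | ifLt y z c₁ c₂, σ => if σ.sc y < σ.sc z then eval 𝓔 c₁ (σ.bump 0 1) else eval 𝓔 c₂ (σ.bump 0 1)
  | ifEmpty v c₁ c₂, σ => if σ.vi v = [] then eval 𝓔 c₁ (σ.bump 0 1) else eval 𝓔 c₂ (σ.bump 0 1)
  | times x c, σ => (eval 𝓔 c)^[σ.sc x] (σ.bump 0 (σ.sc x + 1))
  | ext e, σ => 𝓔.sem e σ

/-- The extension calls along the execution of `c` from `σ` meet their preconditions
(`NExt.pre`); vacuous for programs without extension opcodes (`extOK_of_isEmpty`). [folklore] -/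
def extOK (𝓔 : NExt S V O X E) : NCom S V O E → NState S V O → Prop
  | seq c₁ c₂, σ => extOK 𝓔 c₁ σ ∧ extOK 𝓔 c₂ (c₁.eval 𝓔 σ)
  | ifPos x c₁ c₂, σ => if 0 < σ.sc x then extOK 𝓔 c₁ (σ.bump 0 1) else extOK 𝓔 c₂ (σ.bump 0 1)
  | ifLt y z c₁ c₂, σ => if σ.sc y < σ.sc z then extOK 𝓔 c₁ (σ.bump 0 1) else extOK 𝓔 c₂ (σ.bump 0 1)
  | ifEmpty v c₁ c₂, σ => if σ.vi v = [] then extOK 𝓔 c₁ (σ.bump 0 1) else extOK 𝓔 c₂ (σ.bump 0 1)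
  | times x c, σ => ∀ j < σ.sc x, extOK 𝓔 c ((c.eval 𝓔)^[j] (σ.bump 0 (σ.sc x + 1)))
  | ext e, σ => 𝓔.pre e σ
  | _, _ => True

/-- Programs without extension opcodes meet all preconditions. [folklore] -/
theorem extOK_of_isEmpty [IsEmpty E] (𝓔 : NExt S V O X E) : ∀ (c : NCom S V O E) (σ : NState S V O), c.extOK 𝓔 σ
  | seq c₁ c₂, σ => ⟨extOK_of_isEmpty 𝓔 c₁ σ, extOK_of_isEmpty 𝓔 c₂ _⟩
  | ifPos x c₁ c₂, σ => by unfold extOK; split <;> exact extOK_of_isEmpty 𝓔 _ _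
  | ifLt y z c₁ c₂, σ => by unfold extOK; split <;> exact extOK_of_isEmpty 𝓔 _ _
  | ifEmpty v c₁ c₂, σ => by unfold extOK; split <;> exact extOK_of_isEmpty 𝓔 _ _
  | times x c, σ => fun j _ => extOK_of_isEmpty 𝓔 c _
  | ext e, _ => isEmptyElim e
  | setc _ _, _ => trivial
  | mov _ _, _ => trivial
  | add _ _ _, _ => trivial
  | sub _ _ _, _ => trivial
  | mul _ _ _, _ => trivial
  | divmod _ _ _ _, _ => trivial
  | sizeOf _ _, _ => trivial
  | pop _ _, _ => trivial
  | push _ _, _ => trivial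
  | emit _ _, _ => trivial
  | pour _ _, _ => trivial
  | clearV _, _ => trivial
  | clearO _, _ => trivial
  | skip, _ => trivial

end Eval

/-- Well-formed programs at loop depth `d`: loops nest within the eight counters and the four
operands of `/%` are pairwise distinct (as `nDivMod` wants). Decidable, so checked by `decide`
on concrete programs. [folklore] -/
def wf : ℕ → NCom S V O E → Prop
  | _, divmod q r y z => q ≠ r ∧ q ≠ y ∧ q ≠ z ∧ r ≠ y ∧ r ≠ z
  | _, sizeOf x y => x ≠ y
  | d, seq c₁ c₂ => wf d c₁ ∧ wf d c₂
  | d, ifPos _ c₁ c₂ => wf d c₁ ∧ wf d c₂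
  | d, ifLt _ _ c₁ c₂ => wf d c₁ ∧ wf d c₂
  | d, ifEmpty _ c₁ c₂ => wf d c₁ ∧ wf d c₂
  | d, times _ c => d < 8 ∧ wf (d + 1) c
  | _, _ => True

/-- Well-formedness of programs is decidable. [folklore] -/
instance decWf [DecidableEq S] : ∀ (d : ℕ) (c : NCom S V O E), Decidable (wf d c)
  | _, setc _ _ => isTrue trivial
  | _, mov _ _ => isTrue trivial
  | _, add _ _ _ => isTrue trivial
  | _, sub _ _ _ => isTrue trivial
  | _, mul _ _ _ => isTrue trivial
  | _, divmod _ _ _ _ => by unfold wf; infer_instance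
  | _, sizeOf _ _ => by unfold wf; infer_instance
  | _, pop _ _ => isTrue trivial
  | _, push _ _ => isTrue trivial
  | _, emit _ _ => isTrue trivial
  | _, pour _ _ => isTrue trivial
  | _, clearV _ => isTrue trivial
  | _, clearO _ => isTrue trivial
  | _, skip => isTrue trivial
  | d, seq c₁ c₂ => by unfold wf; haveI := decWf d c₁; haveI := decWf d c₂; infer_instance
  | d, ifPos _ c₁ c₂ => by unfold wf; haveI := decWf d c₁; haveI := decWf d c₂; infer_instance
  | d, ifLt _ _ c₁ c₂ => by unfold wf; haveI := decWf d c₁; haveI := decWf d c₂; infer_instance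
  | d, ifEmpty _ c₁ c₂ => by unfold wf; haveI := decWf d c₁; haveI := decWf d c₂; infer_instance
  | d, times _ c => by unfold wf; haveI := decWf (d + 1) c; infer_instance
  | _, ext _ => isTrue trivial

/-- Well-formedness at a depth gives well-formedness at any smaller depth. [folklore] -/
theorem wf_mono {d d' : ℕ} (h : d' ≤ d) : ∀ {c : NCom S V O E}, wf d c → wf d' c
  | setc _ _, _ => trivial
  | mov _ _, _ => trivial
  | add _ _ _, _ => trivial
  | sub _ _ _, _ => trivial
  | mul _ _ _, _ => trivial
  | divmod _ _ _ _, hw => hw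
  | sizeOf _ _, hw => hw
  | pop _ _, _ => trivial
  | push _ _, _ => trivial
  | emit _ _, _ => trivial
  | pour _ _, _ => trivial
  | clearV _, _ => trivial
  | clearO _, _ => trivial
  | skip, _ => trivial
  | seq _ _, hw => ⟨wf_mono h hw.1, wf_mono h hw.2⟩
  | ifPos _ _ _, hw => ⟨wf_mono h hw.1, wf_mono h hw.2⟩
  | ifLt _ _ _ _, hw => ⟨wf_mono h hw.1, wf_mono h hw.2⟩
  | ifEmpty _ _ _, hw => ⟨wf_mono h hw.1, wf_mono h hw.2⟩
  | times _ _, hw => ⟨lt_of_le_of_lt h hw.1, wf_mono (Nat.succ_le_succ h) hw.2⟩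
  | ext _, _ => trivial

/-! ### Compilation -/

section Compile

variable [DecidableEq S] [DecidableEq V] [DecidableEq O] (𝓔 : NExt S V O X E)

/-- The layer name of an outer register. -/
local notation "⟪" r "⟫" => (Sum.inr r : EReg ⊕ NBank S V O X)

/-- Compilation to a stack program over `EReg ⊕ NBank S V O X`, at loop depth `d`. [folklore] -/
def compile : ℕ → NCom S V O E → Com (EReg ⊕ NBank S V O X)
  | _, setc x c => Com.setConst ⟪rS x⟫ (encodeNat c)
  | _, mov x y => Com.clear ⟪rW .scr⟫ ;; Com.copy ⟪rS y⟫ ⟪rW .scr⟫ (Com.ra .t) (Com.ra .u) ;;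
      Com.clear ⟪rS x⟫ ;; Com.move ⟪rW .scr⟫ ⟪rS x⟫ (Com.ra .s)
  | _, add x y z => Com.nAdd (rS x) (rS y) (rS z)
  | _, sub x y z => Com.nCmp (rW .flg) (rS y) (rS z) ;;
      Com.pop ⟪rW .flg⟫ (Com.nSub (rS x) (rS y) (rS z)) (Com.nSub (rS x) (rS y) (rS z)) (Com.setConst ⟪rS x⟫ [])
  | _, mul x y z => Com.nMul (rS x) (rS y) (rS z)
  | _, divmod q r y z => Com.ifNonempty ⟪rS z⟫ (Com.nDivMod (rS q) (rS r) (rS y) (rS z))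
      (Com.clear ⟪rS q⟫ ;; Com.clear ⟪rS r⟫ ;; Com.copy ⟪rS y⟫ ⟪rS r⟫ (Com.ra .t) (Com.ra .u))
  | _, sizeOf x y => Com.nLen (rS x) (rS y) (rW .scr)
  | _, pop v x => Com.clear ⟪rS x⟫ ;; Com.readItem ⟪rV v⟫ ⟪rW .scr⟫ ⟪rW .tok⟫ ;; Com.pour ⟪rW .scr⟫ ⟪rS x⟫
  | _, push v x => Com.copy ⟪rS x⟫ ⟪rW .scr⟫ (Com.ra .t) (Com.ra .u) ;; Com.pour ⟪rW .scr⟫ ⟪rW .tok⟫ ;;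
      Com.push ⟪rV v⟫ true ;; Com.push ⟪rV v⟫ false ;;
      Com.loop ⟪rW .tok⟫ (Com.push ⟪rV v⟫ true ;; Com.push ⟪rV v⟫ true) (Com.push ⟪rV v⟫ false ;; Com.push ⟪rV v⟫ false)
  | _, emit o x => Com.copy ⟪rS x⟫ ⟪rW .scr⟫ (Com.ra .t) (Com.ra .u) ;; Com.emit ⟪rW .scr⟫ ⟪rO o⟫
  | _, pour o v => Com.pour ⟪rO o⟫ ⟪rV v⟫
  | _, clearV v => Com.clear ⟪rV v⟫
  | _, clearO o => Com.clear ⟪rO o⟫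
  | _, skip => Com.skip
  | d, seq c₁ c₂ => compile d c₁ ;; compile d c₂
  | d, ifPos x c₁ c₂ => Com.ifNonempty ⟪rS x⟫ (compile d c₁) (compile d c₂)
  | d, ifLt y z c₁ c₂ => Com.nCmp (rW .flg) (rS y) (rS z) ;;
      Com.pop ⟪rW .flg⟫ (compile d c₂) (compile d c₂) (compile d c₁)
  | d, ifEmpty v c₁ c₂ => Com.ifNonempty ⟪rV v⟫ (compile d c₂) (compile d c₁)
  | d, times x c => Com.nToUnary (rW (NWork.ctr d)) (rS x) ;; Com.countLoop ⟪rW (NWork.ctr d)⟫ (compile (d + 1) c)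
  | _, ext e => 𝓔.com e

end Compile

end NCom

/-! ### The register coding of abstract states -/

namespace NState

variable {S V O X : Type}

/-- The outer register file of an abstract state: scalars as numerals, queues as `encVec`,
accumulators as reversed emitted lists `outRev`, the loop counters as given by `κ`, every
other work or extension register empty. [folklore] -/
def outer (κ : ℕ → List Bool) (σ : NState S V O) : Regs (NBank S V O X)
  | Sum.inl (Sum.inl (Sum.inl s)) => encodeNat (σ.sc s)
  | Sum.inl (Sum.inl (Sum.inr v)) => encVec (σ.vi v)
  | Sum.inl (Sum.inr o) => Com.outRev ((σ.vo o).map encodeNat)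
  | Sum.inr (Sum.inl w) => if w.depth < 8 then κ w.depth else []
  | Sum.inr (Sum.inr _) => []

/-- The full register file: the three calculator banks clean (`base`). [folklore] -/
abbrev enc (κ : ℕ → List Bool) (σ : NState S V O) : Regs (EReg ⊕ NBank S V O X) := Com.base (outer κ σ)

/-- Reading/writing the coded file: `outer_rS`. [folklore] -/
@[simp] theorem outer_rS (κ : ℕ → List Bool) (σ : NState S V O) (s : S) :
    (outer κ σ : Regs (NBank S V O X)) (rS s) = encodeNat (σ.sc s) := rfl
/-- Reading/writing the coded file: `outer_rV`. [folklore] -/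
@[simp] theorem outer_rV (κ : ℕ → List Bool) (σ : NState S V O) (v : V) :
    (outer κ σ : Regs (NBank S V O X)) (rV v) = encVec (σ.vi v) := rfl
/-- Reading/writing the coded file: `outer_rO`. [folklore] -/
@[simp] theorem outer_rO (κ : ℕ → List Bool) (σ : NState S V O) (o : O) :
    (outer κ σ : Regs (NBank S V O X)) (rO o) = Com.outRev ((σ.vo o).map encodeNat) := rfl
/-- Reading/writing the coded file: `outer_rX`. [folklore] -/
@[simp] theorem outer_rX (κ : ℕ → List Bool) (σ : NState S V O) (x : X) :
    (outer κ σ : Regs (NBank S V O X)) (rX x) = [] := rfl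
/-- Reading/writing the coded file: `outer_tok`. [folklore] -/
@[simp] theorem outer_tok (κ : ℕ → List Bool) (σ : NState S V O) :
    (outer κ σ : Regs (NBank S V O X)) (rW .tok) = [] := rfl
/-- Reading/writing the coded file: `outer_scr`. [folklore] -/
@[simp] theorem outer_scr (κ : ℕ → List Bool) (σ : NState S V O) :
    (outer κ σ : Regs (NBank S V O X)) (rW .scr) = [] := rfl
/-- Reading/writing the coded file: `outer_flg`. [folklore] -/
@[simp] theorem outer_flg (κ : ℕ → List Bool) (σ : NState S V O) :
    (outer κ σ : Regs (NBank S V O X)) (rW .flg) = [] := rfl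
/-- Reading/writing the coded file: `outer_ctr`. [folklore] -/
theorem outer_ctr (κ : ℕ → List Bool) (σ : NState S V O) {d : ℕ} (hd : d < 8) :
    (outer κ σ : Regs (NBank S V O X)) (rW (NWork.ctr d)) = κ d := by
  show (if (NWork.ctr d).depth < 8 then κ (NWork.ctr d).depth else []) = κ d
  rw [NWork.depth_ctr hd, if_pos hd]

end NState

/-! ### Writing the coded register file -/

namespace NState

variable {S V O X : Type}

/-- Reading a work register of the coded file. [folklore] -/
theorem outer_rW (κ : ℕ → List Bool) (σ : NState S V O) (w : NWork) :
    (outer κ σ : Regs (NBank S V O X)) (rW w) = if w.depth < 8 then κ w.depth else [] := rfl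

/-- The coded file ignores the instruments. [folklore] -/
@[simp] theorem outer_bump (κ : ℕ → List Bool) (σ : NState S V O) (a k : ℕ) :
    (outer κ (σ.bump a k) : Regs (NBank S V O X)) = outer κ σ := by
  funext r; rcases r with ((s | v) | o) | (w | x) <;> rfl

section Writes

variable [DecidableEq S] [DecidableEq V] [DecidableEq O] [DecidableEq X]

/-- Writing a scalar register. [folklore] -/
theorem outer_setSc (κ : ℕ → List Bool) (σ : NState S V O) (x : S) (a : ℕ) :
    Function.update (outer κ σ : Regs (NBank S V O X)) (rS x) (encodeNat a) = outer κ (σ.setSc x a) := by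
  funext r
  rcases r with ((s | v) | o) | (w | x')
  · by_cases h : s = x
    · subst h; simp [outer]
    · have h' : (Sum.inl (Sum.inl (Sum.inl s)) : NBank S V O X) ≠ rS x := by simpa using h
      rw [Function.update_of_ne h']; simp [outer, Function.update_of_ne h]
  all_goals (rw [Function.update_of_ne (by simp)]; rfl)

/-- Writing a queue register. [folklore] -/
theorem outer_setVi (κ : ℕ → List Bool) (σ : NState S V O) (v : V) (l : List ℕ) :
    Function.update (outer κ σ : Regs (NBank S V O X)) (rV v) (encVec l) = outer κ (σ.setVi v l) := by
  funext r
  rcases r with ((s | v') | o) | (w | x')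
  · rw [Function.update_of_ne (by simp)]; rfl
  · by_cases h : v' = v
    · subst h; simp [outer]
    · have h' : (Sum.inl (Sum.inl (Sum.inr v')) : NBank S V O X) ≠ rV v := by simpa using h
      rw [Function.update_of_ne h']; simp [outer, Function.update_of_ne h]
  all_goals (rw [Function.update_of_ne (by simp)]; rfl)

/-- Writing an accumulator register. [folklore] -/
theorem outer_setVo (κ : ℕ → List Bool) (σ : NState S V O) (o : O) (l : List ℕ) :
    Function.update (outer κ σ : Regs (NBank S V O X)) (rO o) (Com.outRev (l.map encodeNat)) =
      outer κ (σ.setVo o l) := by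
  funext r
  rcases r with ((s | v) | o') | (w | x')
  · rw [Function.update_of_ne (by simp)]; rfl
  · rw [Function.update_of_ne (by simp)]; rfl
  · by_cases h : o' = o
    · subst h; simp [outer]
    · have h' : (Sum.inl (Sum.inr o') : NBank S V O X) ≠ rO o := by simpa using h
      rw [Function.update_of_ne h']; simp [outer, Function.update_of_ne h]
  all_goals (rw [Function.update_of_ne (by simp)]; rfl)

/-- Writing an empty work register that is coded empty changes nothing. [folklore] -/
theorem outer_update_rW_nil (κ : ℕ → List Bool) (σ : NState S V O) (w : NWork)
    (hw : (outer κ σ : Regs (NBank S V O X)) (rW w) = []) :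
    Function.update (outer κ σ : Regs (NBank S V O X)) (rW w) [] = outer κ σ := by
  rw [← hw]; exact Function.update_eq_self _ _

/-- Writing the loop counter of depth `d < 8`. [folklore] -/
theorem outer_setCtr (κ : ℕ → List Bool) (σ : NState S V O) {d : ℕ} (hd : d < 8) (l : List Bool) :
    Function.update (outer κ σ : Regs (NBank S V O X)) (rW (NWork.ctr d)) l =
      outer (Function.update κ d l) σ := by
  funext r
  rcases r with ((s | v) | o) | (w | x')
  · rw [Function.update_of_ne (by simp)]; rfl
  · rw [Function.update_of_ne (by simp)]; rfl
  · rw [Function.update_of_ne (by simp)]; rfl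
  · rw [Function.update_apply, outer_rW, outer_rW]
    by_cases h : w = NWork.ctr d
    · subst h; rw [if_pos rfl, NWork.depth_ctr hd, if_pos hd, Function.update_self]
    · have h' : (Sum.inr (Sum.inl w) : NBank S V O X) ≠ rW (NWork.ctr d) := by simpa using h
      rw [if_neg h']
      by_cases hw : w.depth < 8
      · rw [if_pos hw, if_pos hw, Function.update_of_ne]
        intro he
        apply h
        revert he hw h
        match d, hd with
        | 0, _ => cases w <;> decide
        | 1, _ => cases w <;> decide
        | 2, _ => cases w <;> decide
        | 3, _ => cases w <;> decide
        | 4, _ => cases w <;> decide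
        | 5, _ => cases w <;> decide
        | 6, _ => cases w <;> decide
        | 7, _ => cases w <;> decide
        | n + 8, h => omega
      · rw [if_neg hw, if_neg hw]
  · rw [Function.update_of_ne (by simp)]; rfl

omit [DecidableEq S] [DecidableEq V] [DecidableEq O] [DecidableEq X] in
/-- The coded register file ignores the instruments. [folklore] -/
@[simp] theorem enc_bump (κ : ℕ → List Bool) (σ : NState S V O) (a k : ℕ) :
    (enc κ (σ.bump a k) : Regs (EReg ⊕ NBank S V O X)) = enc κ σ := by
  show Com.base (outer κ (σ.bump a k)) = Com.base (outer κ σ); rw [outer_bump]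

end Writes

/-! ### Length bounds from `peak` -/

/-- A number below `p` has a numeral of length at most `size p`. [folklore] -/
theorem length_encodeNat_le_size {a p : ℕ} (h : a ≤ p) : (encodeNat a).length ≤ p.size := by
  rw [TM2Pass.length_encodeNat_eq_size]; exact Nat.size_le_size h

/-- The code of a queue of numbers below `p` has length at most `|l| (2 size p + 2)`. [folklore] -/
theorem length_encVec_le_size {l : List ℕ} {p : ℕ} (h : ∀ a ∈ l, a ≤ p) :
    (encVec l).length ≤ l.length * (2 * p.size + 2) :=
  length_encVec_le fun a ha => length_encodeNat_le_size (h a ha)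

/-- The reversed accumulator coding has the length of the queue coding. [folklore] -/
theorem length_outRev_map (l : List ℕ) : (Com.outRev (l.map encodeNat)).length = (encVec l).length := by
  rw [← reverse_outRev_map, List.length_reverse]

/-- Well-formedness of written states. [folklore] -/
theorem WF.setSc [DecidableEq S] {σ : NState S V O} (h : σ.WF) (x : S) {a : ℕ} (ha : a ≤ σ.peak) : (σ.setSc x a).WF :=
  ⟨fun y => by
    simp only [sc_setSc, peak_setSc, Function.update_apply]; split_ifs; exacts [ha, h.sc_le y],
   fun v => h.vi_le v, fun o => h.vo_le o⟩

/-- `WF.setVi`. [folklore] -/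
theorem WF.setVi [DecidableEq V] {σ : NState S V O} (h : σ.WF) (v : V) {l : List ℕ} (hl : ∀ a ∈ l, a ≤ σ.peak) :
    (σ.setVi v l).WF :=
  ⟨fun y => h.sc_le y, fun v' => by
    simp only [vi_setVi, peak_setVi, Function.update_apply]; split_ifs; exacts [hl, h.vi_le v'],
   fun o => h.vo_le o⟩

/-- `WF.setVo`. [folklore] -/
theorem WF.setVo [DecidableEq O] {σ : NState S V O} (h : σ.WF) (o : O) {l : List ℕ} (hl : ∀ a ∈ l, a ≤ σ.peak) :
    (σ.setVo o l).WF :=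
  ⟨fun y => h.sc_le y, fun v => h.vi_le v, fun o' => by
    simp only [vo_setVo, peak_setVo, Function.update_apply]; split_ifs; exacts [hl, h.vo_le o']⟩

/-- `WF.bump`. [folklore] -/
theorem WF.bump {σ : NState S V O} (h : σ.WF) (a k : ℕ) : (σ.bump a k).WF :=
  ⟨fun y => (h.sc_le y).trans (le_max_left _ _), fun v b hb => (h.vi_le v b hb).trans (le_max_left _ _),
   fun o b hb => (h.vo_le o b hb).trans (le_max_left _ _)⟩

/-- Writing a value that the same step records in `peak`. [folklore] -/
theorem WF.setSc_bump [DecidableEq S] {σ : NState S V O} (h : σ.WF) (x : S) (a k : ℕ) : ((σ.setSc x a).bump a k).WF :=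
  ⟨fun y => by
    simp only [sc_bump, sc_setSc, peak_bump, peak_setSc, Function.update_apply]
    split_ifs
    · exact le_max_right _ _
    · exact (h.sc_le y).trans (le_max_left _ _),
   fun v b hb => (h.vi_le v b hb).trans (le_max_left _ _), fun o b hb => (h.vo_le o b hb).trans (le_max_left _ _)⟩

end NState

/-! ### Soundness of extensions; monotonicity and well-formedness of the semantics -/

namespace NExt

variable {S V O X E : Type} [DecidableEq S] [DecidableEq V] [DecidableEq O] [DecidableEq X]

/-- Sound extensions: opcodes preserve well-formedness, only grow the instruments, and — on
states meeting their precondition — their code realises their meaning on coded states within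
`K · Δsteps · (size peak' + 2)³` steps, whatever the loop counters hold. [folklore] -/
structure Sound (𝓔 : NExt S V O X E) (K : ℕ) : Prop where
  wf : ∀ e (σ : NState S V O), σ.WF → (𝓔.sem e σ).WF
  mono : ∀ e (σ : NState S V O), σ.Mono (𝓔.sem e σ)
  runs : ∀ e (σ : NState S V O) (κ : ℕ → List Bool), σ.WF → 𝓔.pre e σ →
    Com.Runs (𝓔.com e) (NState.enc κ σ) (NState.enc κ (𝓔.sem e σ))
      (K * ((𝓔.sem e σ).steps - σ.steps) * ((𝓔.sem e σ).peak.size + 2) ^ 3)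

/-- The empty extension is sound (for any constant). [folklore] -/
theorem empty_sound (K : ℕ) : (NExt.empty S V O X).Sound K :=
  ⟨fun e => e.elim, fun e => e.elim, fun e => e.elim⟩

end NExt

namespace NCom

variable {S V O X E : Type} [DecidableEq S] [DecidableEq V] [DecidableEq O] [DecidableEq X]

section MonoWF

variable {𝓔 : NExt S V O X E} {K : ℕ} (h𝓔 : 𝓔.Sound K)
include h𝓔

/-- The instruments only grow along an execution. [folklore] -/
theorem eval_mono : ∀ (c : NCom S V O E) (σ : NState S V O), σ.Mono (c.eval 𝓔 σ)
  | setc _ _, σ => NState.mono_bump _ _ _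
  | mov _ _, σ => NState.mono_bump _ _ _
  | add _ _ _, σ => NState.mono_bump _ _ _
  | sub _ _ _, σ => NState.mono_bump _ _ _
  | mul _ _ _, σ => NState.mono_bump _ _ _
  | divmod _ _ _ _, σ => NState.mono_bump _ _ _
  | sizeOf _ _, σ => NState.mono_bump _ _ _
  | pop _ _, σ => NState.mono_bump _ _ _
  | push _ _, σ => NState.mono_bump _ _ _
  | emit _ _, σ => NState.mono_bump _ _ _
  | pour _ _, σ => NState.mono_bump _ _ _
  | clearV _, σ => NState.mono_bump _ _ _
  | clearO _, σ => NState.mono_bump _ _ _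
  | skip, _ => NState.Mono.rfl
  | seq c₁ c₂, σ => (eval_mono c₁ σ).trans (eval_mono c₂ _)
  | ifPos x c₁ c₂, σ => by
    unfold eval; split
    exacts [(NState.mono_bump σ 0 1).trans (eval_mono c₁ _), (NState.mono_bump σ 0 1).trans (eval_mono c₂ _)]
  | ifLt y z c₁ c₂, σ => by
    unfold eval; split
    exacts [(NState.mono_bump σ 0 1).trans (eval_mono c₁ _), (NState.mono_bump σ 0 1).trans (eval_mono c₂ _)]
  | ifEmpty v c₁ c₂, σ => by
    unfold eval; split
    exacts [(NState.mono_bump σ 0 1).trans (eval_mono c₁ _), (NState.mono_bump σ 0 1).trans (eval_mono c₂ _)]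
  | times x c, σ => by
    unfold eval
    refine (NState.mono_bump σ 0 (σ.sc x + 1)).trans ?_
    generalize σ.bump 0 (σ.sc x + 1) = τ
    generalize σ.sc x = n
    induction n generalizing τ with
    | zero => exact NState.Mono.rfl
    | succ n ih => rw [Function.iterate_succ_apply]; exact (eval_mono c τ).trans (ih _)
  | ext e, σ => h𝓔.mono e σ

/-- Iterating a program only grows the instruments. [folklore] -/
theorem iterate_mono (c : NCom S V O E) (n : ℕ) (σ : NState S V O) : σ.Mono ((c.eval 𝓔)^[n] σ) := by
  induction n generalizing σ with
  | zero => exact NState.Mono.rfl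
  | succ n ih => rw [Function.iterate_succ_apply]; exact (eval_mono h𝓔 c σ).trans (ih _)

/-- Executions preserve well-formedness. [folklore] -/
theorem eval_WF : ∀ (c : NCom S V O E) {σ : NState S V O}, σ.WF → (c.eval 𝓔 σ).WF
  | setc x a, σ, h => h.setSc_bump x a 1
  | mov x y, σ, h => (h.setSc x (h.sc_le y)).bump 0 1
  | add x y z, σ, h => h.setSc_bump x _ 1
  | sub x y z, σ, h => (h.setSc x ((Nat.sub_le _ _).trans (h.sc_le y))).bump 0 1
  | mul x y z, σ, h => h.setSc_bump x _ 1
  | divmod q r y z, σ, h =>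
    (((h.setSc q ((Nat.div_le_self _ _).trans (h.sc_le y))).setSc r
      ((Nat.mod_le _ _).trans (h.sc_le y)))).bump 0 1
  | sizeOf x y, σ, h => h.setSc_bump x _ 1
  | pop v x, σ, h => by
    refine ((h.setSc x ?_).setVi v fun a ha => h.vi_le v a (List.mem_of_mem_tail ha)).bump 0 1
    cases hv : σ.vi v with
    | nil => exact Nat.zero_le _
    | cons a l => exact h.vi_le v a (by rw [hv]; simp)
  | push v x, σ, h => (h.setVi v (by
      intro a ha
      rcases List.mem_cons.1 ha with rfl | ha
      exacts [h.sc_le x, h.vi_le v a ha])).bump 0 1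
  | emit o x, σ, h => (h.setVo o (by
      intro a ha
      rcases List.mem_append.1 ha with ha | ha
      · exact h.vo_le o a ha
      · rw [List.mem_singleton.1 ha]; exact h.sc_le x)).bump 0 _
  | pour o v, σ, h => ((h.setVi v (by
      intro a ha
      rcases List.mem_append.1 ha with ha | ha
      exacts [h.vo_le o a ha, h.vi_le v a ha])).setVo o (by simp)).bump 0 _
  | clearV v, σ, h => (h.setVi v (by simp)).bump 0 _
  | clearO o, σ, h => (h.setVo o (by simp)).bump 0 _
  | skip, _, h => h
  | seq c₁ c₂, σ, h => eval_WF c₂ (eval_WF c₁ h)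
  | ifPos x c₁ c₂, σ, h => by
    unfold eval; split; exacts [eval_WF c₁ (h.bump 0 1), eval_WF c₂ (h.bump 0 1)]
  | ifLt y z c₁ c₂, σ, h => by
    unfold eval; split; exacts [eval_WF c₁ (h.bump 0 1), eval_WF c₂ (h.bump 0 1)]
  | ifEmpty v c₁ c₂, σ, h => by
    unfold eval; split; exacts [eval_WF c₁ (h.bump 0 1), eval_WF c₂ (h.bump 0 1)]
  | times x c, σ, h => by
    unfold eval
    have h₁ := h.bump 0 (σ.sc x + 1)
    generalize σ.bump 0 (σ.sc x + 1) = τ at h₁ ⊢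
    generalize σ.sc x = n
    induction n generalizing τ with
    | zero => exact h₁
    | succ n ih => rw [Function.iterate_succ_apply]; exact ih _ (eval_WF c h₁)
  | ext e, σ, h => h𝓔.wf e σ h

/-- Iterates preserve well-formedness. [folklore] -/
theorem iterate_WF (c : NCom S V O E) (n : ℕ) {σ : NState S V O} (h : σ.WF) : ((c.eval 𝓔)^[n] σ).WF := by
  induction n generalizing σ with
  | zero => exact h
  | succ n ih => rw [Function.iterate_succ_apply]; exact ih (eval_WF h𝓔 c h)

end MonoWF

/-! ### The cost bound -/

/-- The absolute constant of the simulation theorem (the numeric procedures' constants).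
[folklore] -/
def K0 : ℕ := 512

/-- The budget of a state change: `K · Δsteps · (size peak' + 2)³`. [folklore] -/
def costB (K : ℕ) (σ τ : NState S V O) : ℕ := K * (τ.steps - σ.steps) * (τ.peak.size + 2) ^ 3

omit [DecidableEq S] [DecidableEq V] [DecidableEq O] [DecidableEq X] in
/-- Budgets compose along monotone state changes. [folklore] -/
theorem costB_seq (K : ℕ) {σ τ υ : NState S V O} (h₁ : σ.Mono τ) (h₂ : τ.Mono υ) :
    costB K σ τ + costB K τ υ ≤ costB K σ υ := by
  unfold costB
  have hs : Nat.size τ.peak + 2 ≤ Nat.size υ.peak + 2 := Nat.add_le_add_right (Nat.size_le_size h₂.1) 2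
  have hp : (Nat.size τ.peak + 2) ^ 3 ≤ (Nat.size υ.peak + 2) ^ 3 := Nat.pow_le_pow_left hs 3
  calc K * (τ.steps - σ.steps) * (Nat.size τ.peak + 2) ^ 3 + K * (υ.steps - τ.steps) * (Nat.size υ.peak + 2) ^ 3
      ≤ K * (τ.steps - σ.steps) * (Nat.size υ.peak + 2) ^ 3 + K * (υ.steps - τ.steps) * (Nat.size υ.peak + 2) ^ 3 :=
        Nat.add_le_add_right (Nat.mul_le_mul_left _ hp) _
    _ = K * (υ.steps - σ.steps) * (Nat.size υ.peak + 2) ^ 3 := by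
        rw [← Nat.add_mul, ← Nat.mul_add]
        congr 2
        have := h₁.2; have := h₂.2; omega

omit [DecidableEq S] [DecidableEq V] [DecidableEq O] [DecidableEq X] in
/-- A budget with one more abstract step absorbs an overhead `a ≤ K (size peak' + 2)³`. [folklore] -/
theorem costB_bump {K a : ℕ} {σ υ : NState S V O} {τ : NState S V O} (ha : a ≤ K * 1 * (υ.peak.size + 2) ^ 3)
    (hτs : τ.steps = σ.steps + 1) (h₂ : τ.Mono υ) :
    costB K τ υ + a ≤ costB K σ υ := by
  unfold costB
  have hsteps : υ.steps - σ.steps = (υ.steps - τ.steps) + 1 := by have := h₂.2; omega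
  rw [hsteps, Nat.mul_add, Nat.add_mul]
  exact Nat.add_le_add_left ha _

omit [DecidableEq S] [DecidableEq V] [DecidableEq O] [DecidableEq X] in
/-- The elementary budget of one instruction: `a (w+2)² + b ≤ K · k · (w+2)³` when
`a + b ≤ K`, `1 ≤ k`. [folklore] -/
theorem quad_le_costB {K a b k w : ℕ} (hab : a + b ≤ K) (hk : 1 ≤ k) :
    a * (w + 2) ^ 2 + b ≤ K * k * (w + 2) ^ 3 := by
  have h2 : 1 ≤ (w + 2) ^ 2 := Nat.one_le_pow _ _ (by omega)
  have hw : (w + 2) ^ 2 ≤ (w + 2) ^ 3 := Nat.pow_le_pow_right (by omega) (by omega)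
  calc a * (w + 2) ^ 2 + b ≤ a * (w + 2) ^ 2 + b * (w + 2) ^ 2 := by nlinarith
    _ = (a + b) * (w + 2) ^ 2 := by ring
    _ ≤ K * k * (w + 2) ^ 2 := Nat.mul_le_mul_right _ (by nlinarith)
    _ ≤ K * k * (w + 2) ^ 3 := Nat.mul_le_mul_left _ hw

omit [DecidableEq S] [DecidableEq V] [DecidableEq O] [DecidableEq X] in
/-- The elementary budget of one instruction, linear form. [folklore] -/
theorem lin_le_costB {K a b k w : ℕ} (hab : a + b ≤ K) (hk : 1 ≤ k) :
    a * (w + 2) + b ≤ K * k * (w + 2) ^ 3 := by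
  have hw : w + 2 ≤ (w + 2) ^ 2 := by nlinarith
  calc a * (w + 2) + b ≤ a * (w + 2) ^ 2 + b := Nat.add_le_add_right (Nat.mul_le_mul_left _ hw) _
    _ ≤ K * k * (w + 2) ^ 3 := quad_le_costB hab hk

omit [DecidableEq S] [DecidableEq V] [DecidableEq O] [DecidableEq X] in
/-- The elementary budget of a whole-register instruction: `a k (w+2) + b ≤ K · k · (w+2)³` when
`a + b ≤ K`, `1 ≤ k`. [folklore] -/
theorem lin_le_costB' {K a b k w : ℕ} (hab : a + b ≤ K) (hk : 1 ≤ k) :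
    a * k * (w + 2) + b ≤ K * k * (w + 2) ^ 3 := by
  have hw : w + 2 ≤ (w + 2) ^ 3 := Nat.le_self_pow (by norm_num) _
  have hb : b ≤ b * k * (w + 2) := by
    rw [Nat.mul_assoc]; exact Nat.le_mul_of_pos_right _ (Nat.mul_pos (by omega) (by omega))
  calc a * k * (w + 2) + b ≤ a * k * (w + 2) + b * k * (w + 2) := Nat.add_le_add_left hb _
    _ = (a + b) * k * (w + 2) := by ring
    _ ≤ K * k * (w + 2) := by gcongr
    _ ≤ K * k * (w + 2) ^ 3 := Nat.mul_le_mul_left _ hw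

/-- The numeral of `0` is empty (file-local copy of `TokConv.encodeNat_zero'`, `TokenStreams.lean`,
not imported here). [folklore] -/
private theorem encodeNat_zero' : encodeNat 0 = [] := rfl

/-! ### A counted loop with a potential -/

omit [DecidableEq S] [DecidableEq V] [DecidableEq O] [DecidableEq X] in
/-- **Counted loop, potential form.** If from the file `F j` (counter `U = 1^{n-j}`) the body,
started after the pop, reaches `F (j+1)` within `Φ (j+1) - Φ j` steps for a monotone potential
`Φ`, then `countLoop U body` takes `F j` to `F n` within `Φ n - Φ j + 2 (n - j) + 1` steps.
[folklore] -/
theorem runs_countLoop_pot {ι : Type} [DecidableEq ι] {U : ι} {body : Com ι} (F : ℕ → Regs ι)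
    (Φ : ℕ → ℕ) (n : ℕ) (hΦ : Monotone Φ) (hU : ∀ j ≤ n, F j U = List.replicate (n - j) true)
    (hbody : ∀ j < n, Com.Runs body (Function.update (F j) U (List.replicate (n - j - 1) true)) (F (j + 1))
      (Φ (j + 1) - Φ j)) :
    ∀ j ≤ n, Com.Runs (Com.countLoop U body) (F j) (F n) (Φ n - Φ j + 2 * (n - j) + 1) := by
  intro j hj
  induction hm : n - j generalizing j with
  | zero =>
    have hjn : j = n := by omega
    subst hjn
    exact (Com.Runs.loop_nil _ _ (by rw [hU j le_rfl, Nat.sub_self]; rfl)).of_eq rfl (by omega)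
  | succ m ih =>
    have hjn : j < n := by omega
    have h1 := hbody j hjn
    rw [show n - j - 1 = m by omega] at h1
    have h2 := ih (j + 1) hjn (by omega)
    have hUj : F j U = true :: List.replicate m true := by rw [hU j hj, hm, List.replicate_succ]
    refine (Com.Runs.loop_true hUj h1 h2).of_eq rfl ?_
    have := hΦ (show j ≤ j + 1 by omega); have := hΦ (show j + 1 ≤ n by omega)
    omega

/-- `dbl` of a concatenation. [folklore] -/
theorem dbl_append' (u w : List Bool) : dbl (u ++ w) = dbl u ++ dbl w := by
  simp [dbl, List.flatMap_append]

omit [DecidableEq S] [DecidableEq V] [DecidableEq O] [DecidableEq X] in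
/-- The doubling loop of `push`: popping the bits `w` of `t` and pushing each twice onto `v`
leaves `dbl wʳ` on top of `v`, in `4 |w| + 1` steps. [folklore] -/
theorem runs_dblLoop {ι : Type} [DecidableEq ι] {t v : ι} (htv : t ≠ v) :
    ∀ (w : List Bool) (R : Regs ι), R t = w →
      Com.Runs (Com.loop t (Com.push v true ;; Com.push v true) (Com.push v false ;; Com.push v false)) R
        (Function.update (Function.update R t []) v (dbl w.reverse ++ R v)) (4 * w.length + 1)
  | [], R, ht => by
    refine (Com.Runs.loop_nil _ _ ht).of_eq ?_ (by simp)
    rw [List.reverse_nil, dbl_nil, List.nil_append, ← ht, Function.update_eq_self, Function.update_eq_self]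
  | b :: w, R, ht => by
    have hb : Com.Runs (bif b then (Com.push v true ;; Com.push v true) else (Com.push v false ;; Com.push v false))
        (Function.update R t w) (Function.update (Function.update R t w) v (b :: b :: R v)) 2 := by
      cases b
      · refine ((Com.Runs.push v false _).seq (Com.Runs.push v false _)).of_eq ?_ le_rfl
        rw [Function.update_idem]; simp [Function.update_of_ne htv.symm]
      · refine ((Com.Runs.push v true _).seq (Com.Runs.push v true _)).of_eq ?_ le_rfl
        rw [Function.update_idem]; simp [Function.update_of_ne htv.symm]
    have ih := runs_dblLoop htv w (Function.update (Function.update R t w) v (b :: b :: R v))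
      (by rw [Function.update_of_ne htv, Function.update_self])
    have e : Function.update (Function.update (Function.update (Function.update R t w) v (b :: b :: R v)) t [])
        v (dbl w.reverse ++ (Function.update (Function.update R t w) v (b :: b :: R v)) v) =
        Function.update (Function.update R t []) v (dbl (b :: w).reverse ++ R v) := by
      rw [Function.update_self, List.reverse_cons, dbl_append', dbl_cons, dbl_nil, List.append_assoc]
      rw [Function.update_comm htv, Function.update_idem, Function.update_comm htv.symm, Function.update_idem]
      rfl
    rw [e] at ih
    cases b
    · exact (Com.Runs.loop_false ht hb ih).of_eq rfl (by simp; omega)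
    · exact (Com.Runs.loop_true ht hb ih).of_eq rfl (by simp; omega)

/-! ### The simulation theorem -/

section Runs

variable {𝓔 : NExt S V O X E} {K : ℕ} (h𝓔 : 𝓔.Sound K) (hK : K0 ≤ K)
include h𝓔 hK

/-- Local shorthand for the layer name of an outer register. -/
local notation "⟪" r "⟫" => (Sum.inr r : EReg ⊕ NBank S V O X)

/-- Local shorthand for the coded outer file. -/
local notation "𝕋" => NState.outer (S := S) (V := V) (O := O) (X := X)

omit h𝓔 hK in
/-- A positive scalar is coded by a nonempty register. [folklore] -/
theorem encodeNat_eq_cons_of_pos {a : ℕ} (ha : 0 < a) : ∃ b w, encodeNat a = b :: w := by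
  cases h : encodeNat a with
  | nil => have := bitsToNat_encodeNat a; rw [h] at this; simp [bitsToNat] at this; omega
  | cons b w => exact ⟨b, w, rfl⟩

omit h𝓔 hK in
/-- A nonempty queue is coded by a nonempty register. [folklore] -/
theorem encVec_eq_cons (a : ℕ) (l : List ℕ) : ∃ b w, encVec (a :: l) = b :: w := by
  cases h : encVec (a :: l) with
  | nil => exact absurd h (encVec_cons_ne_nil a l)
  | cons b w => exact ⟨b, w, rfl⟩

/-- **The simulation theorem for numeric register programs.**  For a well-formed program at
depth `d`, a well-formed abstract state and loop counters empty from depth `d` on, the compiled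
stack program takes the coded state to the coded final state of `eval`, within
`K · Δsteps · (size peak' + 2)³` steps. [folklore] -/
theorem runs : ∀ (c : NCom S V O E) (d : ℕ), c.wf d → ∀ (σ : NState S V O), σ.WF → c.extOK 𝓔 σ →
    ∀ (κ : ℕ → List Bool), (∀ i, d ≤ i → i < 8 → κ i = []) →
      Com.Runs (c.compile 𝓔 d) (NState.enc κ σ : Regs (EReg ⊕ NBank S V O X))
        (NState.enc κ (c.eval 𝓔 σ)) (costB K σ (c.eval 𝓔 σ)) := by
  have hK1 : 512 ≤ K := hK
  intro c
  induction c with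
  | setc x c =>
    intro d _ σ hσ _ κ _
    simp only [compile, eval]
    refine (Com.runs_setConst ⟪rS x⟫ (encodeNat c) (NState.enc κ σ)).of_eq ?_ ?_
    · rw [NState.enc_bump]; simp only [Com.update_nst_inr, NState.outer_setSc]
    · simp only [Com.nst_inr, NState.outer_rS, costB, NState.steps_bump, NState.steps_setSc,
        NState.peak_bump, NState.peak_setSc, Nat.add_sub_cancel_left]
      have h1 : (encodeNat (σ.sc x)).length ≤ (max σ.peak c).size :=
        NState.length_encodeNat_le_size ((hσ.sc_le x).trans (le_max_left _ _))
      have h2 : (encodeNat c).length ≤ (max σ.peak c).size := NState.length_encodeNat_le_size (le_max_right _ _)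
      calc 2 * (encodeNat (σ.sc x)).length + 1 + (encodeNat c).length ≤ 3 * ((max σ.peak c).size + 2) + 0 := by omega
        _ ≤ K * 1 * ((max σ.peak c).size + 2) ^ 3 := lin_le_costB (by omega) le_rfl
  | skip =>
    intro d _ σ _ _ κ _
    simp only [compile, eval]
    exact (Com.Runs.skip _).of_eq rfl (Nat.zero_le _)
  | seq c₁ c₂ ih₁ ih₂ =>
    intro d hw σ hσ hok κ hκ
    simp only [compile, eval]
    have h₁ := ih₁ d hw.1 σ hσ hok.1 κ hκ
    have h₂ := ih₂ d hw.2 _ (eval_WF h𝓔 c₁ hσ) hok.2 κ hκ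
    exact (h₁.seq h₂).of_eq rfl (costB_seq K (eval_mono h𝓔 c₁ σ) (eval_mono h𝓔 c₂ _))
  | ext e =>
    intro d _ σ hσ hok κ _
    simp only [compile, eval]
    exact h𝓔.runs e σ κ hσ hok
  | mov x y =>
    intro d _ σ hσ _ κ _
    simp only [compile, eval]
    have hy := NState.length_encodeNat_le_size (hσ.sc_le y)
    have hx := NState.length_encodeNat_le_size (hσ.sc_le x)
    have h1 := Com.runs_oclear (rW .scr) (𝕋 κ σ)
    have e1 : Function.update (𝕋 κ σ) (rW .scr) [] = 𝕋 κ σ := NState.outer_update_rW_nil κ σ _ rfl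
    rw [e1] at h1
    have h2 := Com.runs_ocopy (a := rS y) (b := rW .scr) (by simp) (𝕋 κ σ)
    simp only [NState.outer_rS, NState.outer_scr, List.append_nil] at h1 h2
    set T₂ := Function.update (𝕋 κ σ) (rW .scr) (encodeNat (σ.sc y)) with hT₂
    have h3 := Com.runs_oclear (rS x) T₂
    have hT₂x : T₂ (rS x) = encodeNat (σ.sc x) := by rw [hT₂, Function.update_of_ne (by simp)]; rfl
    rw [hT₂x] at h3
    set T₃ := Function.update T₂ (rS x) [] with hT₃
    have h4 := Com.runs_omove (a := rW .scr) (b := rS x) (by simp) T₃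
    have hT₃s : T₃ (rW .scr) = encodeNat (σ.sc y) := by
      rw [hT₃, Function.update_of_ne (by simp), hT₂, Function.update_self]
    have hT₃x : T₃ (rS x) = [] := by rw [hT₃, Function.update_self]
    rw [hT₃s, hT₃x, List.append_nil] at h4
    refine (h1.seq (h2.seq (h3.seq h4))).of_eq ?_ ?_
    · rw [NState.enc_bump]; show Com.base _ = Com.base _; congr 1
      rw [hT₃, Function.update_comm (by simp), Function.update_idem, hT₂, Function.update_comm (by simp),
        Function.update_idem, e1, NState.outer_setSc]
    · simp only [costB, NState.steps_bump, NState.steps_setSc, NState.peak_bump, NState.peak_setSc,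
        Nat.add_sub_cancel_left, Nat.max_zero, List.length_nil]
      exact le_trans (b := 18 * (σ.peak.size + 2) + 0) (by omega) (lin_le_costB (by omega) le_rfl)
  | add x y z =>
    intro d _ σ hσ _ κ _
    simp only [compile, eval]
    have hy := NState.length_encodeNat_le_size ((hσ.sc_le y).trans (le_max_left _ (σ.sc y + σ.sc z)))
    have hz := NState.length_encodeNat_le_size ((hσ.sc_le z).trans (le_max_left _ (σ.sc y + σ.sc z)))
    have hx := NState.length_encodeNat_le_size ((hσ.sc_le x).trans (le_max_left _ (σ.sc y + σ.sc z)))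
    have h := Com.runs_nAdd (rS x) (rS y) (rS z) (𝕋 κ σ) (n := (max σ.peak (σ.sc y + σ.sc z)).size)
      (by simpa using hy) (by simpa using hz) (by simp only [NState.outer_rS]; omega)
    simp only [NState.outer_rS, bitsToNat_encodeNat] at h
    refine h.of_eq ?_ ?_
    · rw [NState.enc_bump]; show Com.base _ = Com.base _; rw [NState.outer_setSc]
    · simp only [costB, NState.steps_bump, NState.steps_setSc, NState.peak_bump, NState.peak_setSc,
        Nat.add_sub_cancel_left]
      exact le_trans (b := 65 * ((max σ.peak (σ.sc y + σ.sc z)).size + 2) + 0) (by omega) (lin_le_costB (by omega) le_rfl)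
  | sub x y z =>
    intro d _ σ hσ _ κ _
    simp only [compile, eval]
    have hy := NState.length_encodeNat_le_size (hσ.sc_le y)
    have hz := NState.length_encodeNat_le_size (hσ.sc_le z)
    have hx := NState.length_encodeNat_le_size (hσ.sc_le x)
    have h1 := Com.runs_nCmp (rW .flg) (rS y) (rS z) (𝕋 κ σ) (n := σ.peak.size) (by simpa using hy) (by simpa using hz) rfl
    simp only [NState.outer_rS, bitsToNat_encodeNat] at h1
    have hcost : 56 * (σ.peak.size + 1) + (71 * (σ.peak.size + 1) + 2 * (encodeNat (σ.sc x)).length + 1 + 2) ≤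
        costB K σ ((σ.setSc x (σ.sc y - σ.sc z)).bump 0 1) := by
      simp only [costB, NState.steps_bump, NState.steps_setSc, NState.peak_bump, NState.peak_setSc,
        Nat.add_sub_cancel_left, Nat.max_zero]
      calc 56 * (σ.peak.size + 1) + (71 * (σ.peak.size + 1) + 2 * (encodeNat (σ.sc x)).length + 1 + 2)
          ≤ 129 * (σ.peak.size + 2) + 0 := by omega
        _ ≤ K * 1 * (σ.peak.size + 2) ^ 3 := lin_le_costB (by omega) le_rfl
    by_cases hle : σ.sc z ≤ σ.sc y
    · rw [decide_eq_true hle, flag_true] at h1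
      have hT' : Function.update (Function.update (𝕋 κ σ) (rW .flg) [true]) (rW .flg) [] = 𝕋 κ σ := by
        rw [Function.update_idem]; exact NState.outer_update_rW_nil κ σ _ rfl
      have h2 := Com.runs_nSub (rS x) (rS y) (rS z) (𝕋 κ σ) (n := σ.peak.size) (by simpa using hy) (by simpa using hz)
        (by simp only [NState.outer_rS]; omega) (by simpa using hle)
      simp only [NState.outer_rS, bitsToNat_encodeNat] at h2
      have h3 := Com.Runs.opop_true (k := rW .flg) (Com.nSub (rS x) (rS y) (rS z)) (Com.setConst ⟪rS x⟫ [])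
        (T := Function.update (𝕋 κ σ) (rW .flg) [true]) (w := []) (by simp) (by rw [hT']; exact h2)
      refine (h1.seq h3).of_eq ?_ (le_trans (by omega) hcost)
      rw [NState.enc_bump]; show Com.base _ = Com.base _; rw [NState.outer_setSc]
    · rw [decide_eq_false hle, flag_false] at h1
      rw [NState.outer_update_rW_nil κ σ _ rfl] at h1
      have h2 := Com.runs_setConst ⟪rS x⟫ ([] : List Bool) (NState.enc κ σ)
      simp only [Com.nst_inr, NState.outer_rS, List.length_nil, Nat.add_zero] at h2
      have h3 := Com.Runs.opop_nil (k := rW .flg) (Com.nSub (rS x) (rS y) (rS z)) (Com.nSub (rS x) (rS y) (rS z))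
        (T := 𝕋 κ σ) rfl h2
      refine (h1.seq h3).of_eq ?_ (le_trans (by omega) hcost)
      rw [NState.enc_bump]; simp only [Com.update_nst_inr]; show Com.base _ = Com.base _
      rw [show σ.sc y - σ.sc z = 0 by omega, ← NState.outer_setSc]; rfl
  | mul x y z =>
    intro d _ σ hσ _ κ _
    simp only [compile, eval]
    have hy := NState.length_encodeNat_le_size ((hσ.sc_le y).trans (le_max_left _ (σ.sc y * σ.sc z)))
    have hz := NState.length_encodeNat_le_size ((hσ.sc_le z).trans (le_max_left _ (σ.sc y * σ.sc z)))
    have hx := NState.length_encodeNat_le_size ((hσ.sc_le x).trans (le_max_left _ (σ.sc y * σ.sc z)))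
    have h := Com.runs_nMul (rS x) (rS y) (rS z) (𝕋 κ σ) (n := (max σ.peak (σ.sc y * σ.sc z)).size)
      (by simpa using hy) (by simpa using hz) (by simp only [NState.outer_rS]; omega)
    simp only [NState.outer_rS, bitsToNat_encodeNat] at h
    refine h.of_eq ?_ ?_
    · rw [NState.enc_bump]; show Com.base _ = Com.base _; rw [NState.outer_setSc]
    · simp only [costB, NState.steps_bump, NState.steps_setSc, NState.peak_bump, NState.peak_setSc,
        Nat.add_sub_cancel_left]
      have : ((max σ.peak (σ.sc y * σ.sc z)).size + 1) ^ 2 ≤ ((max σ.peak (σ.sc y * σ.sc z)).size + 2) ^ 2 :=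
        Nat.pow_le_pow_left (by omega) 2
      exact le_trans (b := 270 * ((max σ.peak (σ.sc y * σ.sc z)).size + 2) ^ 2 + 0) (by omega)
        (quad_le_costB (by omega) le_rfl)
  | divmod q r y z =>
    intro d hw σ hσ _ κ _
    simp only [compile, eval]
    obtain ⟨hqr, hqy, hqz, hry, hrz⟩ := hw
    have hy := NState.length_encodeNat_le_size (hσ.sc_le y)
    have hz := NState.length_encodeNat_le_size (hσ.sc_le z)
    have hq := NState.length_encodeNat_le_size (hσ.sc_le q)
    have hr := NState.length_encodeNat_le_size (hσ.sc_le r)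
    have hcostB : ∀ {C : ℕ}, C ≤ 353 * (σ.peak.size + 2) ^ 2 →
        C ≤ costB K σ (((σ.setSc q (σ.sc y / σ.sc z)).setSc r (σ.sc y % σ.sc z)).bump 0 1) := by
      intro C hC
      simp only [costB, NState.steps_bump, NState.steps_setSc, NState.peak_bump, NState.peak_setSc,
        Nat.add_sub_cancel_left, Nat.max_zero]
      exact hC.trans ((Nat.le_add_right _ 0).trans (quad_le_costB (by omega) le_rfl))
    have hfin : Function.update (Function.update (𝕋 κ σ) (rS q) (encodeNat (σ.sc y / σ.sc z))) (rS r)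
        (encodeNat (σ.sc y % σ.sc z)) = 𝕋 κ ((σ.setSc q (σ.sc y / σ.sc z)).setSc r (σ.sc y % σ.sc z)) := by
      rw [NState.outer_setSc, NState.outer_setSc]
    by_cases hz0 : 0 < σ.sc z
    · obtain ⟨b, w, hbw⟩ := encodeNat_eq_cons_of_pos hz0
      have h2 := Com.runs_nDivMod (qd := rS q) (rd := rS r) (a := rS y) (b := rS z) (by simpa using hqr)
        (by simpa using hqy) (by simpa using hqz) (by simpa using hry) (by simpa using hrz) (𝕋 κ σ)
        (n := σ.peak.size) (by simpa using hy) (by simpa using hz) (by simpa using hq) (by simpa using hr)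
        (by simpa using hz0)
      simp only [NState.outer_rS, bitsToNat_encodeNat] at h2
      have h := Com.runs_ifNonempty_cons (L := ⟪rS z⟫)
        (Com.clear ⟪rS q⟫ ;; Com.clear ⟪rS r⟫ ;; Com.copy ⟪rS y⟫ ⟪rS r⟫ (Com.ra .t) (Com.ra .u))
        (R := NState.enc κ σ) (b := b) (rest := w) (by simpa using hbw) h2
      refine h.of_eq ?_ (hcostB ?_)
      · rw [NState.enc_bump]; show Com.base _ = Com.base _; rw [hfin]
      · have : (σ.peak.size + 1) ^ 2 ≤ (σ.peak.size + 2) ^ 2 := Nat.pow_le_pow_left (by omega) 2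
        nlinarith
    · have hz0' : σ.sc z = 0 := by omega
      have h1 := Com.runs_oclear (rS q) (𝕋 κ σ)
      simp only [NState.outer_rS] at h1
      set T₁ := Function.update (𝕋 κ σ) (rS q) [] with hT₁
      have h2 := Com.runs_oclear (rS r) T₁
      have hT₁r : T₁ (rS r) = encodeNat (σ.sc r) := by rw [hT₁, Function.update_of_ne (by simpa using hqr.symm)]; rfl
      rw [hT₁r] at h2
      set T₂ := Function.update T₁ (rS r) [] with hT₂
      have h3 := Com.runs_ocopy (a := rS y) (b := rS r) (by simpa using hry.symm) T₂
      have hT₂y : T₂ (rS y) = encodeNat (σ.sc y) := by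
        rw [hT₂, Function.update_of_ne (by simpa using hry.symm), hT₁, Function.update_of_ne (by simpa using hqy.symm)]; rfl
      have hT₂r : T₂ (rS r) = [] := by rw [hT₂, Function.update_self]
      rw [hT₂y, hT₂r, List.append_nil] at h3
      have h := Com.runs_ifNonempty_nil (L := ⟪rS z⟫) (Com.nDivMod (rS q) (rS r) (rS y) (rS z))
        (R := NState.enc κ σ) (by simp [hz0', encodeNat_zero']) (h1.seq (h2.seq h3))
      refine h.of_eq ?_ (hcostB ?_)
      · rw [NState.enc_bump]; show Com.base _ = Com.base _; congr 1
        rw [hT₂, Function.update_idem, hT₁, ← hfin, hz0', Nat.div_zero, Nat.mod_zero]; rfl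
      · nlinarith
  | pop v x =>
    intro d _ σ hσ _ κ _
    simp only [compile, eval]
    have hx := NState.length_encodeNat_le_size (hσ.sc_le x)
    have h1 := Com.runs_oclear (rS x) (𝕋 κ σ)
    simp only [NState.outer_rS] at h1
    set T₁ := Function.update (𝕋 κ σ) (rS x) [] with hT₁
    have hT₁v : T₁ (rV v) = encVec (σ.vi v) := by rw [hT₁, Function.update_of_ne (by simp)]; rfl
    have hT₁t : T₁ (rW .tok) = [] := by rw [hT₁, Function.update_of_ne (by simp)]; rfl
    have hT₁s : T₁ (rW .scr) = [] := by rw [hT₁, Function.update_of_ne (by simp)]; rfl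
    have hT₁x : T₁ (rS x) = [] := by rw [hT₁, Function.update_self]
    have hcostB : ∀ {C : ℕ}, C ≤ 17 * (σ.peak.size + 2) →
        C ≤ costB K σ (((σ.setSc x ((σ.vi v).headD 0)).setVi v (σ.vi v).tail).bump 0 1) := by
      intro C hC
      simp only [costB, NState.steps_bump, NState.steps_setSc, NState.steps_setVi, NState.peak_bump,
        NState.peak_setSc, NState.peak_setVi, Nat.add_sub_cancel_left, Nat.max_zero]
      exact hC.trans ((Nat.le_add_right _ 0).trans (lin_le_costB (by omega) le_rfl))
    cases hv : σ.vi v with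
    | nil =>
      have h2 := Com.runs_readItem_nil (L := ⟪rV v⟫) (A := ⟪rW .scr⟫) (w := ⟪rW .tok⟫) (by simp) (Com.base T₁)
        (by simpa [hv] using hT₁v) (by simpa using hT₁t)
      have h3 := Com.runs_opour (a := rW .scr) (b := rS x) (by simp) T₁
      rw [hT₁s, hT₁x] at h3
      simp only [List.reverse_nil, List.append_nil, List.length_nil, Nat.mul_zero, Nat.zero_add] at h3
      refine (h1.seq (h2.seq h3)).of_eq ?_ (hcostB (by omega))
      rw [NState.enc_bump]; show Com.base _ = Com.base _; congr 1
      rw [Function.update_comm (by simp), Function.update_idem, Function.update_comm (by simp),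
        NState.outer_update_rW_nil κ σ _ rfl]
      simp only [List.headD_nil, List.tail_nil]
      rw [← NState.outer_setVi, ← NState.outer_setSc, encVec_nil, encodeNat_zero']
      refine (Function.update_eq_self_iff.2 ?_).symm
      rw [Function.update_of_ne (by simp), NState.outer_rV, hv, encVec_nil]
    | cons a l =>
      have ha : a ≤ σ.peak := hσ.vi_le v a (by rw [hv]; simp)
      have hal := NState.length_encodeNat_le_size ha
      have h2 := Com.runs_readItem (L := ⟪rV v⟫) (A := ⟪rW .scr⟫) (w := ⟪rW .tok⟫) (by simp) (by simp) (by simp)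
        (encodeNat a) (encVec l) (Com.base T₁) (by simpa [hv, encVec_cons] using hT₁v) (by simpa using hT₁t)
      simp only [Com.update_nst_inr, Com.nst_inr, hT₁s, List.append_nil] at h2
      set T₂ := Function.update (Function.update T₁ (rV v) (encVec l)) (rW .scr) (encodeNat a).reverse with hT₂
      have h3 := Com.runs_opour (a := rW .scr) (b := rS x) (by simp) T₂
      have hT₂s : T₂ (rW .scr) = (encodeNat a).reverse := by rw [hT₂, Function.update_self]
      have hT₂x : T₂ (rS x) = [] := by
        rw [hT₂, Function.update_of_ne (by simp), Function.update_of_ne (by simp), hT₁x]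
      rw [hT₂s, hT₂x, List.reverse_reverse, List.append_nil, List.length_reverse] at h3
      refine (h1.seq (h2.seq h3)).of_eq ?_ (hcostB (by omega))
      rw [NState.enc_bump]; show Com.base _ = Com.base _; congr 1
      rw [hT₂, Function.update_idem, hT₁]
      -- update (update (update (update T x []) v (encVec l)) scr []) x (encodeNat a)
      rw [Function.update_comm (a := rW .scr) (b := rS x) (by simp)]
      rw [Function.update_comm (a := rV v) (b := rS x) (by simp), Function.update_idem]
      rw [Function.update_comm (a := rS x) (b := rV v) (by simp)]
      rw [Function.update_comm (a := rS x) (b := rW .scr) (by simp), Function.update_comm (a := rV v) (b := rW .scr) (by simp),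
        NState.outer_update_rW_nil κ σ _ rfl]
      simp only [List.headD_cons, List.tail_cons]
      rw [← NState.outer_setVi, ← NState.outer_setSc]
      exact Function.update_comm (by simp) _ _ _
  | sizeOf x y =>
    intro d hw σ hσ _ κ _
    simp only [compile, eval]
    have hxy : x ≠ y := hw
    have hy := NState.length_encodeNat_le_size ((hσ.sc_le y).trans (le_max_left _ (σ.sc y).size))
    have hx := NState.length_encodeNat_le_size ((hσ.sc_le x).trans (le_max_left _ (σ.sc y).size))
    have h := Com.runs_nLen (dst := rS x) (src := rS y) (tmp := rW .scr) (by simpa using hxy) (by simp) (by simp) (𝕋 κ σ)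
      (n := (max σ.peak (σ.sc y).size).size) (by simpa using hy) (by simpa using hx) rfl
    simp only [NState.outer_rS, TM2Pass.length_encodeNat_eq_size] at h
    refine h.of_eq ?_ ?_
    · rw [NState.enc_bump]; show Com.base _ = Com.base _; rw [NState.outer_setSc]
    · simp only [costB, NState.steps_bump, NState.steps_setSc, NState.peak_bump, NState.peak_setSc,
        Nat.add_sub_cancel_left]
      have : ((max σ.peak (σ.sc y).size).size + 1) ^ 2 ≤ ((max σ.peak (σ.sc y).size).size + 2) ^ 2 :=
        Nat.pow_le_pow_left (by omega) 2
      exact le_trans (b := 90 * ((max σ.peak (σ.sc y).size).size + 2) ^ 2 + 0) (by omega)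
        (quad_le_costB (by omega) le_rfl)
  | push v x =>
    intro d _ σ hσ _ κ _
    simp only [compile, eval]
    have hx := NState.length_encodeNat_le_size (hσ.sc_le x)
    have h1 := Com.runs_ocopy (a := rS x) (b := rW .scr) (by simp) (𝕋 κ σ)
    simp only [NState.outer_rS, NState.outer_scr, List.append_nil] at h1
    set T₁ := Function.update (𝕋 κ σ) (rW .scr) (encodeNat (σ.sc x)) with hT₁
    have h2 := Com.runs_opour (a := rW .scr) (b := rW .tok) (by simp) T₁
    have hT₁s : T₁ (rW .scr) = encodeNat (σ.sc x) := by rw [hT₁, Function.update_self]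
    have hT₁t : T₁ (rW .tok) = [] := by rw [hT₁, Function.update_of_ne (by simp)]; rfl
    rw [hT₁s, hT₁t, List.append_nil] at h2
    set T₂ := Function.update (Function.update T₁ (rW .scr) []) (rW .tok) (encodeNat (σ.sc x)).reverse with hT₂
    have h3 := Com.Runs.opush (rV v) true T₂
    set T₃ := Function.update T₂ (rV v) (true :: T₂ (rV v)) with hT₃
    have h4 := Com.Runs.opush (rV v) false T₃
    set T₄ := Function.update T₃ (rV v) (false :: T₃ (rV v)) with hT₄
    have h5 := runs_dblLoop (t := ⟪rW .tok⟫) (v := ⟪rV v⟫) (by simp) (encodeNat (σ.sc x)).reverse (Com.base T₄)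
      (by simp only [Com.nst_inr]; rw [hT₄, Function.update_of_ne (by simp), hT₃, Function.update_of_ne (by simp), hT₂,
            Function.update_self])
    simp only [Com.update_nst_inr, Com.nst_inr, List.reverse_reverse, List.length_reverse] at h5
    refine (h1.seq (h2.seq (h3.seq (h4.seq h5)))).of_eq ?_ ?_
    · rw [NState.enc_bump]; show Com.base _ = Com.base _; congr 1
      have hv4 : T₄ (rV v) = false :: true :: encVec (σ.vi v) := by
        rw [hT₄, Function.update_self, hT₃, Function.update_self, hT₂, Function.update_of_ne (by simp),
          Function.update_of_ne (by simp), hT₁, Function.update_of_ne (by simp)]; rfl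
      rw [hv4, show dbl (encodeNat (σ.sc x)) ++ false :: true :: encVec (σ.vi v) =
        encVec (σ.sc x :: σ.vi v) from (encVec_cons _ _).symm]
      rw [hT₄, Function.update_comm (a := rW .tok) (b := rV v) (by simp), Function.update_idem, hT₃, Function.update_idem,
        hT₂, Function.update_comm (a := rV v) (b := rW .tok) (by simp), Function.update_idem, hT₁, Function.update_idem,
        NState.outer_update_rW_nil κ σ _ rfl, NState.outer_update_rW_nil κ σ _ rfl, NState.outer_setVi]
    · simp only [costB, NState.steps_bump, NState.steps_setVi, NState.peak_bump, NState.peak_setVi,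
        Nat.add_sub_cancel_left, Nat.max_zero]
      exact le_trans (b := 17 * (σ.peak.size + 2) + 0) (by omega) (lin_le_costB (by omega) le_rfl)
  | emit o x =>
    intro d _ σ hσ _ κ _
    simp only [compile, eval]
    have hx := NState.length_encodeNat_le_size (hσ.sc_le x)
    have h1 := Com.runs_ocopy (a := rS x) (b := rW .scr) (by simp) (𝕋 κ σ)
    simp only [NState.outer_rS, NState.outer_scr, List.append_nil] at h1
    set T₁ := Function.update (𝕋 κ σ) (rW .scr) (encodeNat (σ.sc x)) with hT₁
    have h2 := Com.runs_emit (h := ⟪rW .scr⟫) (o := ⟪rO o⟫) (by simp) (Com.base T₁)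
    have hT₁s : T₁ (rW .scr) = encodeNat (σ.sc x) := by rw [hT₁, Function.update_self]
    have hT₁o : T₁ (rO o) = Com.outRev ((σ.vo o).map encodeNat) := by rw [hT₁, Function.update_of_ne (by simp)]; rfl
    simp only [Com.update_nst_inr, Com.nst_inr, hT₁s, hT₁o] at h2
    refine (h1.seq h2).of_eq ?_ ?_
    · rw [NState.enc_bump]; show Com.base _ = Com.base _; congr 1
      rw [hT₁, Function.update_idem, ← Com.outRev_append]
      have e : (σ.vo o).map encodeNat ++ [encodeNat (σ.sc x)] = (σ.vo o ++ [σ.sc x]).map encodeNat := by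
        rw [List.map_append, List.map_cons, List.map_nil]
      rw [e, Function.update_comm (by simp), NState.outer_setVo]
      exact NState.outer_update_rW_nil κ _ _ rfl
    · simp only [costB, NState.steps_bump, NState.steps_setVo, NState.peak_bump, NState.peak_setVo,
        Nat.add_sub_cancel_left, Nat.max_zero]
      exact le_trans (b := 14 * (σ.peak.size + 2) + 0) (by omega) (lin_le_costB (by omega) le_rfl)
  | pour o v =>
    intro d _ σ hσ _ κ _
    simp only [compile, eval]
    have hlen := NState.length_encVec_le_size (hσ.vo_le o)
    have h := Com.runs_opour (a := rO o) (b := rV v) (by simp) (𝕋 κ σ)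
    simp only [NState.outer_rO, NState.outer_rV, reverse_outRev_map, NState.length_outRev_map] at h
    rw [← encVec_append] at h
    refine h.of_eq ?_ ?_
    · rw [NState.enc_bump]; show Com.base _ = Com.base _; congr 1
      rw [← NState.outer_setVo, ← NState.outer_setVi, List.map_nil, Com.outRev_nil]
      exact Function.update_comm (by simp) _ _ _
    · simp only [costB, NState.steps_bump, NState.steps_setVo, NState.steps_setVi, NState.peak_bump, NState.peak_setVo,
        NState.peak_setVi, Nat.add_sub_cancel_left, Nat.max_zero]
      refine le_trans (b := 6 * ((σ.vo o).length + 1) * (σ.peak.size + 2) + 1) ?_ (lin_le_costB' (by omega) (by omega))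
      nlinarith
  | clearV v =>
    intro d _ σ hσ _ κ _
    simp only [compile, eval]
    have hlen := NState.length_encVec_le_size (hσ.vi_le v)
    have h := Com.runs_oclear (rV v) (𝕋 κ σ)
    simp only [NState.outer_rV] at h
    refine h.of_eq ?_ ?_
    · rw [NState.enc_bump]; show Com.base _ = Com.base _; congr 1
      rw [← NState.outer_setVi, encVec_nil]
    · simp only [costB, NState.steps_bump, NState.steps_setVi, NState.peak_bump, NState.peak_setVi,
        Nat.add_sub_cancel_left, Nat.max_zero]
      refine le_trans (b := 4 * ((σ.vi v).length + 1) * (σ.peak.size + 2) + 1) ?_ (lin_le_costB' (by omega) (by omega))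
      nlinarith
  | clearO o =>
    intro d _ σ hσ _ κ _
    simp only [compile, eval]
    have hlen := NState.length_encVec_le_size (hσ.vo_le o)
    have h := Com.runs_oclear (rO o) (𝕋 κ σ)
    simp only [NState.outer_rO, NState.length_outRev_map] at h
    refine h.of_eq ?_ ?_
    · rw [NState.enc_bump]; show Com.base _ = Com.base _; congr 1
      rw [← NState.outer_setVo, List.map_nil, Com.outRev_nil]
    · simp only [costB, NState.steps_bump, NState.steps_setVo, NState.peak_bump, NState.peak_setVo,
        Nat.add_sub_cancel_left, Nat.max_zero]
      refine le_trans (b := 4 * ((σ.vo o).length + 1) * (σ.peak.size + 2) + 1) ?_ (lin_le_costB' (by omega) (by omega))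
      nlinarith
  | ifPos x c₁ c₂ ih₁ ih₂ =>
    intro d hw σ hσ hok κ hκ
    simp only [compile, eval]
    by_cases hx : 0 < σ.sc x
    · rw [if_pos hx]
      simp only [extOK, if_pos hx] at hok
      obtain ⟨b, w, hbw⟩ := encodeNat_eq_cons_of_pos hx
      have h := ih₁ d hw.1 (σ.bump 0 1) (hσ.bump 0 1) hok κ hκ
      rw [NState.enc_bump] at h
      refine (Com.runs_ifNonempty_cons (L := ⟪rS x⟫) (compile 𝓔 d c₂) (R := NState.enc κ σ) (b := b) (rest := w)
        (by simpa using hbw) h).of_eq rfl ?_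
      exact costB_bump (le_trans (by omega) (lin_le_costB (a := 0) (b := 3) (by omega) le_rfl)) rfl (eval_mono h𝓔 c₁ _)
    · rw [if_neg hx]
      simp only [extOK, if_neg hx] at hok
      have hx0 : σ.sc x = 0 := by omega
      have h := ih₂ d hw.2 (σ.bump 0 1) (hσ.bump 0 1) hok κ hκ
      rw [NState.enc_bump] at h
      refine (Com.runs_ifNonempty_nil (L := ⟪rS x⟫) (compile 𝓔 d c₁) (R := NState.enc κ σ)
        (by simp [hx0, encodeNat_zero']) h).of_eq rfl ?_
      exact costB_bump (le_trans (by omega) (lin_le_costB (a := 0) (b := 2) (by omega) le_rfl)) rfl (eval_mono h𝓔 c₂ _)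
  | ifLt y z c₁ c₂ ih₁ ih₂ =>
    intro d hw σ hσ hok κ hκ
    simp only [compile, eval]
    have hy := NState.length_encodeNat_le_size (hσ.sc_le y)
    have hz := NState.length_encodeNat_le_size (hσ.sc_le z)
    have h1 := Com.runs_nCmp (rW .flg) (rS y) (rS z) (𝕋 κ σ) (n := σ.peak.size) (by simpa using hy) (by simpa using hz) rfl
    simp only [NState.outer_rS, bitsToNat_encodeNat] at h1
    by_cases hlt : σ.sc y < σ.sc z
    · rw [if_pos hlt]
      simp only [extOK, if_pos hlt] at hok
      rw [decide_eq_false (not_le.2 hlt), flag_false, NState.outer_update_rW_nil κ σ _ rfl] at h1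
      have h := ih₁ d hw.1 (σ.bump 0 1) (hσ.bump 0 1) hok κ hκ
      rw [NState.enc_bump] at h
      have h3 := Com.Runs.opop_nil (k := rW .flg) (compile 𝓔 d c₂) (compile 𝓔 d c₂) (T := 𝕋 κ σ) rfl h
      refine (h1.seq h3).of_eq rfl ?_
      have hps : σ.peak.size ≤ (eval 𝓔 c₁ (σ.bump 0 1)).peak.size :=
        Nat.size_le_size ((NState.mono_bump σ 0 1).trans (eval_mono h𝓔 c₁ _)).1
      have := costB_bump (K := K) (σ := σ) (a := 56 * (σ.peak.size + 1) + 2)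
        (le_trans (by omega) (lin_le_costB (a := 56) (b := 2) (by omega) le_rfl)) rfl (eval_mono h𝓔 c₁ (σ.bump 0 1))
      omega
    · rw [if_neg hlt]
      simp only [extOK, if_neg hlt] at hok
      rw [decide_eq_true (not_lt.1 hlt), flag_true] at h1
      have hT' : Function.update (Function.update (𝕋 κ σ) (rW .flg) [true]) (rW .flg) [] = 𝕋 κ σ := by
        rw [Function.update_idem]; exact NState.outer_update_rW_nil κ σ _ rfl
      have h := ih₂ d hw.2 (σ.bump 0 1) (hσ.bump 0 1) hok κ hκ
      rw [NState.enc_bump] at h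
      have h3 := Com.Runs.opop_true (k := rW .flg) (compile 𝓔 d c₂) (compile 𝓔 d c₁)
        (T := Function.update (𝕋 κ σ) (rW .flg) [true]) (w := []) (by simp) (by rw [hT']; exact h)
      refine (h1.seq h3).of_eq rfl ?_
      have hps : σ.peak.size ≤ (eval 𝓔 c₂ (σ.bump 0 1)).peak.size :=
        Nat.size_le_size ((NState.mono_bump σ 0 1).trans (eval_mono h𝓔 c₂ _)).1
      have := costB_bump (K := K) (σ := σ) (a := 56 * (σ.peak.size + 1) + 2)
        (le_trans (by omega) (lin_le_costB (a := 56) (b := 2) (by omega) le_rfl)) rfl (eval_mono h𝓔 c₂ (σ.bump 0 1))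
      omega
  | ifEmpty v c₁ c₂ ih₁ ih₂ =>
    intro d hw σ hσ hok κ hκ
    simp only [compile, eval]
    cases hv : σ.vi v with
    | nil =>
      rw [if_pos rfl]
      simp only [extOK, hv, if_true] at hok
      have h := ih₁ d hw.1 (σ.bump 0 1) (hσ.bump 0 1) hok κ hκ
      rw [NState.enc_bump] at h
      refine (Com.runs_ifNonempty_nil (L := ⟪rV v⟫) (compile 𝓔 d c₂) (R := NState.enc κ σ)
        (by simp [hv]) h).of_eq rfl ?_
      exact costB_bump (le_trans (by omega) (lin_le_costB (a := 0) (b := 2) (by omega) le_rfl)) rfl (eval_mono h𝓔 c₁ _)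
    | cons a l =>
      rw [if_neg (List.cons_ne_nil a l)]
      simp only [extOK, hv, List.cons_ne_nil, if_false] at hok
      obtain ⟨b, w, hbw⟩ := encVec_eq_cons a l
      have h := ih₂ d hw.2 (σ.bump 0 1) (hσ.bump 0 1) hok κ hκ
      rw [NState.enc_bump] at h
      refine (Com.runs_ifNonempty_cons (L := ⟪rV v⟫) (compile 𝓔 d c₁) (R := NState.enc κ σ) (b := b) (rest := w)
        (by simp [hv, hbw]) h).of_eq rfl ?_
      exact costB_bump (le_trans (by omega) (lin_le_costB (a := 0) (b := 3) (by omega) le_rfl)) rfl (eval_mono h𝓔 c₂ _)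
  | times x c ih =>
    intro d hw σ hσ hok κ hκ
    simp only [compile, eval]
    obtain ⟨hd8, hwc⟩ := hw
    -- names
    have hx := NState.length_encodeNat_le_size (hσ.sc_le x)
    set n := σ.sc x with hn
    set σ₁ := σ.bump 0 (n + 1) with hσ₁
    have hσ₁ : σ₁.WF := hσ.bump 0 (n + 1)
    set σ' := (eval 𝓔 c)^[n] σ₁ with hσ'
    -- iterates
    have hit : ∀ j, ((eval 𝓔 c)^[j] σ₁).WF := fun j => iterate_WF h𝓔 c j hσ₁
    have hmono : ∀ {i j}, i ≤ j → ((eval 𝓔 c)^[i] σ₁).Mono ((eval 𝓔 c)^[j] σ₁) := by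
      intro i j hij
      obtain ⟨k, rfl⟩ := Nat.exists_eq_add_of_le hij
      rw [Nat.add_comm, Function.iterate_add_apply]
      exact iterate_mono h𝓔 c k _
    -- the counter file at round j
    obtain ⟨κ', hκ'⟩ : ∃ κ' : ℕ → ℕ → List Bool, ∀ j, κ' j = Function.update κ d (List.replicate (n - j) true) :=
      ⟨_, fun _ => rfl⟩
    have hκ'i : ∀ j i, d + 1 ≤ i → i < 8 → κ' j i = [] := by
      intro j i hi hi8
      rw [hκ' j, Function.update_of_ne (by omega : i ≠ d)]; exact hκ i (by omega) hi8
    -- 1. the counter is put up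
    have hctr : (𝕋 κ σ) (rW (NWork.ctr d)) = [] := by rw [NState.outer_ctr κ σ hd8]; exact hκ d le_rfl hd8
    have h1 := Com.runs_nToUnary (rW (NWork.ctr d)) (rS x) (𝕋 κ σ) hctr
    simp only [NState.outer_rS, bitsToNat_encodeNat] at h1
    rw [NState.outer_setCtr κ σ hd8, ← hn] at h1
    -- 2. the loop
    set Q := (σ'.peak.size + 2) ^ 3 with hQ
    obtain ⟨Φ, hΦ⟩ : ∃ Φ : ℕ → ℕ, ∀ j, Φ j = K * (((eval 𝓔 c)^[j] σ₁).steps - σ₁.steps) * Q := ⟨_, fun _ => rfl⟩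
    have hΦm : Monotone Φ := by
      intro i j hij
      rw [hΦ, hΦ]
      exact Nat.mul_le_mul_right _ (Nat.mul_le_mul_left _ (Nat.sub_le_sub_right (hmono hij).2 _))
    have hloop := runs_countLoop_pot (U := ⟪rW (NWork.ctr d)⟫) (body := compile 𝓔 (d + 1) c)
      (fun j => (NState.enc (κ' j) ((eval 𝓔 c)^[j] σ₁) : Regs (EReg ⊕ NBank S V O X))) Φ n hΦm
      (fun j _ => by simp only [Com.nst_inr]; rw [NState.outer_ctr _ _ hd8, hκ' j, Function.update_self])
      (by
        intro j hj
        have h := ih (d + 1) hwc ((eval 𝓔 c)^[j] σ₁) (hit j) (hok j (by omega)) (κ' (j + 1)) (hκ'i (j + 1))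
        rw [← Function.iterate_succ_apply' (eval 𝓔 c) j σ₁] at h
        have e : Function.update (NState.enc (κ' j) ((eval 𝓔 c)^[j] σ₁) : Regs (EReg ⊕ NBank S V O X))
            ⟪rW (NWork.ctr d)⟫ (List.replicate (n - j - 1) true) = NState.enc (κ' (j + 1)) ((eval 𝓔 c)^[j] σ₁) := by
          simp only [Com.update_nst_inr]
          rw [NState.outer_setCtr _ _ hd8, hκ' j, hκ' (j + 1), Function.update_idem, show n - j - 1 = n - (j + 1) by omega]
        have h' : Com.Runs (compile 𝓔 (d + 1) c)
            (Function.update (NState.enc (κ' j) ((eval 𝓔 c)^[j] σ₁) : Regs (EReg ⊕ NBank S V O X))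
              ⟪rW (NWork.ctr d)⟫ (List.replicate (n - j - 1) true))
            (NState.enc (κ' (j + 1)) ((eval 𝓔 c)^[j + 1] σ₁)) (costB K ((eval 𝓔 c)^[j] σ₁) ((eval 𝓔 c)^[j + 1] σ₁)) := by
          rw [e]; exact h
        refine h'.of_eq rfl ?_
        · -- costB ≤ Φ (j+1) - Φ j
          apply Nat.le_sub_of_add_le
          rw [hΦ, hΦ]
          simp only [costB]
          have hs₁ := (hmono (Nat.zero_le j)).2
          have hs₂ := (hmono (Nat.le_add_right j 1)).2
          simp only [Function.iterate_zero, id_eq] at hs₁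
          have hp : (((eval 𝓔 c)^[j + 1] σ₁).peak.size + 2) ^ 3 ≤ Q :=
            Nat.pow_le_pow_left (Nat.add_le_add_right (Nat.size_le_size (hmono hj).1) 2) 3
          calc K * (((eval 𝓔 c)^[j + 1] σ₁).steps - ((eval 𝓔 c)^[j] σ₁).steps) *
                (((eval 𝓔 c)^[j + 1] σ₁).peak.size + 2) ^ 3 + K * (((eval 𝓔 c)^[j] σ₁).steps - σ₁.steps) * Q
              ≤ K * (((eval 𝓔 c)^[j + 1] σ₁).steps - ((eval 𝓔 c)^[j] σ₁).steps) * Q +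
                K * (((eval 𝓔 c)^[j] σ₁).steps - σ₁.steps) * Q := Nat.add_le_add_right (Nat.mul_le_mul_left _ hp) _
            _ = K * (((eval 𝓔 c)^[j + 1] σ₁).steps - σ₁.steps) * Q := by
                rw [← Nat.add_mul, ← Nat.mul_add]; congr 2; omega)
      0 (Nat.zero_le _)
    -- 3. assemble
    have hΦ0 : Φ 0 = 0 := by rw [hΦ]; simp
    have hκn : κ' n = κ := by
      rw [hκ' n, Nat.sub_self, List.replicate_zero]; exact Function.update_eq_self_iff.2 (hκ d le_rfl hd8).symm
    have hκ0 : κ' 0 = Function.update κ d (List.replicate n true) := by rw [hκ' 0, Nat.sub_zero]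
    rw [hΦ0, Nat.sub_zero, Nat.sub_zero, hκn, hκ0, Function.iterate_zero, id_eq] at hloop
    rw [← NState.outer_bump (X := X) (Function.update κ d (List.replicate n true)) σ 0 (n + 1)] at h1
    refine (h1.seq hloop).of_eq rfl ?_
    -- cost: |x| (16 n + 21) + 5 + (Φ n + 2 n + 1) ≤ costB K σ σ'
    have hsteps : σ'.steps - σ.steps = (σ'.steps - σ₁.steps) + (n + 1) := by
      have := (hmono (Nat.zero_le n)).2
      simp only [Function.iterate_zero, id_eq] at this
      rw [← hσ'] at this
      have e : σ₁.steps = σ.steps + (n + 1) := rfl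
      omega
    have hP : σ.peak.size ≤ σ'.peak.size := by
      have := (hmono (Nat.zero_le n)).1
      simp only [Function.iterate_zero, id_eq] at this
      exact Nat.size_le_size (le_trans (le_max_left _ 0) this)
    show _ ≤ K * (σ'.steps - σ.steps) * Q
    rw [hsteps, Nat.mul_add K, Nat.add_mul _ _ Q]
    have hover : (encodeNat n).length * (16 * n + 21) + 5 + (2 * n + 1) ≤ K * (n + 1) * Q := by
      refine le_trans (b := 21 * (n + 1) * (σ'.peak.size + 2) + 0) ?_ (lin_le_costB' (by omega) (by omega))
      have hxn : (encodeNat n).length ≤ σ'.peak.size := hx.trans hP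
      nlinarith
    rw [hΦ n, ← hσ']
    omega

/-- **The simulation theorem, top-level form**: at depth `0` with all loop counters empty, a
well-formed program takes the coded state to the coded final state within
`K · Δsteps · (size peak' + 2)³` steps. [folklore] -/
theorem runs₀ (c : NCom S V O E) (hc : c.wf 0) (σ : NState S V O) (hσ : σ.WF) (hok : c.extOK 𝓔 σ) :
    Com.Runs (c.compile 𝓔 0) (NState.enc (fun _ => []) σ : Regs (EReg ⊕ NBank S V O X))
      (NState.enc (fun _ => []) (c.eval 𝓔 σ)) (costB K σ (c.eval 𝓔 σ)) :=
  runs h𝓔 hK c 0 hc σ hσ hok _ fun _ _ _ => rfl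

end Runs

/-- The simulation theorem for programs without extension opcodes, with the constant `K0`.
[folklore] -/
theorem runs_empty (c : NCom S V O Empty) (hc : c.wf 0) (σ : NState S V O) (hσ : σ.WF) :
    Com.Runs (c.compile (NExt.empty S V O X) 0) (NState.enc (fun _ => []) σ : Regs (EReg ⊕ NBank S V O X))
      (NState.enc (fun _ => []) (c.eval (NExt.empty S V O X) σ)) (costB K0 σ (c.eval (NExt.empty S V O X) σ)) :=
  runs₀ (NExt.empty_sound (S := S) (V := V) (O := O) (X := X) K0) le_rfl c hc σ hσ (extOK_of_isEmpty _ c σ)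

end NCom

end Literature.Computability.Complexity
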